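import Literature.NumberTheory.LFunctions.VinogradovMeanValueStepA
import Literature.NumberTheory.LFunctions.FordExpSumSmallLambda
import HarnessLib

/-!
# Ford's Lemma 6.3: from Vinogradov's integral to the zeta sums `∑ (n+u)^{-it}`

Topic `Literature/NumberTheory/LFunctions`.  Everything in this file is PROVED; no named fact
(`def … : Prop`) is introduced.

K. Ford, *Vinogradov's integral and bounds for the Riemann zeta function*, Proc. London Math.
Soc. 85 (2002), 565–633 (= arXiv:1910.08209), §6, relates the zeta sums
`S(N,t) = max_{0<u≤1} max_{N<R≤2N} |∑_{N<n≤R} (n+u)^{-it}|` to Vinogradov's integral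
`J_{s,k}(P)` (the number of solutions of `∑_{i≤s} (x_i^j - y_i^j) = 0`, `1 ≤ j ≤ k`,
`1 ≤ x_i, y_i ≤ P`; here `VMV.J k s [1, P]` of `VinogradovMeanValueCount.lean`) by "an older method"
(Titchmarsh, *The theory of the Riemann zeta-function*, §6.12):

* `FordVK.weylShift` — Ford (6.1): for `1 ≤ M ≤ N`,
  `|∑_{N<n≤R} F(n)| ≤ M⁻¹ ∑_{N<n≤R-1} |∑_{m≤M} F(n+m)| + N/M + M` (`|F| ≤ 1`);
* `FordVK.ford_lemma63` — **Lemma 6.3**: for `k ≥ 2`, `s ≥ 1`, `1 ≤ N < R ≤ 2N`, `0 < u ≤ 1`,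
  `N ≤ t ≤ N^k`, `1 ≤ M`, `t M^{k+1} ≤ N^{k+1}`,
  `|∑_{N<n≤R} (n+u)^{-it}| ≤ (4N^{1-1/(2s)}/M) (π^k k! k^k W M^{k(k+1)/2} J_{s,k}(⌊M⌋))^{1/(2s)} + N/M + M`,
  `W = 2^{k+2} N^{k+1}/(k² t M^k) + 1` (`FordVK.Wconst`);
* `FordVK.ford_cor64` — **Corollary 6.4** (in the form used for Lemma 6.8): if
  `J_{nk,k}(P) ≤ C P^{2nk - k(k+1)/2 + Δ}` (`P ≥ 1`), then for `k ≥ 4`, `N^{k-1} ≤ t ≤ N^k`,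
  `|∑_{N<n≤R} (n+u)^{-it}| ≤ (4 (k! (2πk)^k C)^{1/(2nk)} + 2) N^{1-c}`, `c = (1 - (2+2Δ)/(k+1))/(2nk)`;
* `FordVK.bound_transfer` — Ford (6.6): `S ≤ min(N, C N^{1-c})` gives `S ≤ C^{d/c} N^{1-d}`
  (`0 < d ≤ c`).

The proof of Lemma 6.3 is Ford's: Taylor expansion of `-(t/2π) log(1 + m/(n+u))` to order `k` with coefficients
`γ_j(n)` (`FordVK.gam`, `FordVK.taylor_identity`), the box `Ω_n = ∏_j [γ_j ± 1/(2πjkM^j)]`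
(`FordVK.Omega`, `FordVK.del`) on which the remainder `φ` has `|φ'| ≤ 1/(πM)` (Ford (6.8),
`FordVK.abs_phi'_le_inv`), summation by parts `|T(n)| ≤ S₀(β) = |A_{⌊M⌋}(β)| + (2/M)∑_{m<⌊M⌋}|A_m(β)|`
(`FordVK.norm_Tsum_le_S0`; discrete, so that no `w`-integrals are needed), the average over `Ω_n`
(`FordVK.norm_Tsum_pow_mul_le_integral`), the count "at most `W` values of `n` for a given `β`"
(`FordVK.sum_chi_le_W`, through the spacing `|γ_k(n) - γ_k(n')| ≥ |n-n'| t/(2π(2N)^{k+1})`), and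
`∫_{[0,1]^k} S₀^{2s} ≤ 2^{4s} J_{s,k}(⌊M⌋)` (`FordVK.integral_S0_pow_le`, from
`VMV.integral_norm_sq_tp`).  The reduction of the integrals over the scattered boxes `Ω_n ⊂ ℝ^k` to
the unit torus uses `FordVK.setIntegral_unitBox_eq_of_periodic` (integrals of `ℤ^k`-periodic
functions over unit boxes do not depend on the box; from `UnitAddCircle.measurePreserving_mk` and
`MeasureTheory.measurePreserving_pi`) and the periodized indicator `FordVK.chi` of the last
coordinate.

This is the bridge through which explicit forms of Vinogradov's mean value theorem give Ford's
Theorem 2 (`S(N,t) ≤ 9.463 N^{1-1/(133.66 λ²)}`) in the range `2.6 ≤ λ ≤ 87` (Ford, Lemma 6.8), the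
remaining input of `zeta_bound_ford_of_exp_sum_bound_large_lambda`
(`FordExpSumSmallLambda.lean`) towards `Literature.NumberTheory.LFunctions.zeta_bound_ford`.

## References

* K. Ford, *Vinogradov's integral and bounds for the Riemann zeta function*, Proc. London Math.
  Soc. (3) 85 (2002), 565–633; arXiv:1910.08209. (6.1), Lemma 6.3, (6.6)–(6.9), Corollary 6.4.
  [Ford2002]
* E. C. Titchmarsh, *The Theory of the Riemann Zeta-Function*, 2nd ed. (1986), §6.12. [Titchmarsh1986]
* A. Ivić, *The Riemann Zeta-Function* (1985), §6.2 (the counting function `J`, via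
  `VinogradovMeanValueCount.lean` / `VinogradovTorus.lean`). [Ivic1985]
-/

noncomputable section

open Finset MeasureTheory Complex Real
open scoped Real

namespace Literature.NumberTheory.LFunctions
namespace FordVK

open VdC VMV

/-! ### Integrals of `ℤ^k`-periodic functions over unit boxes -/

/-- The half-open unit box `∏_j (a_j, a_j + 1]` with lower corner `a ∈ ℝ^k`. [folklore] -/
def unitBox {k : ℕ} (a : Fin k → ℝ) : Set (Fin k → ℝ) :=
  Set.univ.pi fun j => Set.Ioc (a j) (a j + 1)

/-- `unitBox a` is measurable. [folklore] -/
theorem measurableSet_unitBox {k : ℕ} (a : Fin k → ℝ) : MeasurableSet (unitBox a) :=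
  MeasurableSet.univ_pi fun _ => measurableSet_Ioc

/-- The covering map `ℝ^k → (ℝ/ℤ)^k` restricted to a unit box is measure preserving. [folklore] -/
theorem measurePreserving_coe_unitBox {k : ℕ} (a : Fin k → ℝ) :
    MeasurePreserving (fun (x : Fin k → ℝ) (j : Fin k) => ((x j : ℝ) : UnitAddCircle))
      (volume.restrict (unitBox a)) (volume : Measure (Fin k → UnitAddCircle)) := by
  have h := measurePreserving_pi
    (fun j : Fin k => (volume : Measure ℝ).restrict (Set.Ioc (a j) (a j + 1)))
    (fun _ : Fin k => (volume : Measure UnitAddCircle))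
    (f := fun _ x => ((x : ℝ) : UnitAddCircle)) (fun j => UnitAddCircle.measurePreserving_mk (a j))
  have hsrc : (volume : Measure (Fin k → ℝ)).restrict (unitBox a)
      = Measure.pi (fun j : Fin k => (volume : Measure ℝ).restrict (Set.Ioc (a j) (a j + 1))) := by
    rw [volume_pi, unitBox, Measure.restrict_pi_pi]
  rw [hsrc, volume_pi]
  exact h

/-- A measurable section of the covering map `(ℝ/ℤ)^k → ℝ^k`. [folklore] -/
def torusSection (k : ℕ) (θ : Fin k → UnitAddCircle) : Fin k → ℝ :=
  fun j => ((AddCircle.equivIoc (1 : ℝ) 0 (θ j) : Set.Ioc (0 : ℝ) (0 + 1)) : ℝ)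

/-- The section is measurable. [folklore] -/
theorem measurable_torusSection (k : ℕ) : Measurable (torusSection k) := by
  refine measurable_pi_lambda _ fun j => ?_
  have h1 : Measurable (AddCircle.equivIoc (1 : ℝ) (0 : ℝ)) :=
    (AddCircle.measurableEquivIoc (1 : ℝ) 0).measurable
  exact measurable_subtype_coe.comp (h1.comp (measurable_pi_apply j))

/-- The section followed by the covering map differs from the identity by an integer vector.
[folklore] -/
theorem torusSection_coe_sub_int {k : ℕ} (x : Fin k → ℝ) :
    ∃ v : Fin k → ℤ, torusSection k (fun j => ((x j : ℝ) : UnitAddCircle)) = fun j => x j + v j := by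
  have : ∀ j, ∃ n : ℤ,
      torusSection k (fun j => ((x j : ℝ) : UnitAddCircle)) j = x j + n := by
    intro j
    have h1 : ((torusSection k (fun j => ((x j : ℝ) : UnitAddCircle)) j : ℝ) : UnitAddCircle)
        = ((x j : ℝ) : UnitAddCircle) := by
      simp only [torusSection]
      exact AddCircle.coe_equivIoc
    have h2 : (((torusSection k (fun j => ((x j : ℝ) : UnitAddCircle)) j - x j : ℝ)) :
        UnitAddCircle) = 0 := by
      rw [AddCircle.coe_sub, h1, sub_self]
    obtain ⟨n, hn⟩ := (AddCircle.coe_eq_zero_iff (1 : ℝ)).1 h2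
    refine ⟨n, ?_⟩
    rw [zsmul_eq_mul, mul_one] at hn
    linarith
  choose v hv using this
  exact ⟨v, funext hv⟩

/-- **Integrals of `ℤ^k`-periodic functions over unit boxes do not depend on the box.**
[folklore] -/
theorem setIntegral_unitBox_eq_of_periodic {k : ℕ} {F : (Fin k → ℝ) → ℝ} (hF : Measurable F)
    (hper : ∀ (x : Fin k → ℝ) (v : Fin k → ℤ), F (fun j => x j + v j) = F x) (a b : Fin k → ℝ) :
    ∫ x in unitBox a, F x = ∫ x in unitBox b, F x := by
  have hσ := measurable_torusSection k
  have hfac : ∀ x : Fin k → ℝ, F (torusSection k (fun j => ((x j : ℝ) : UnitAddCircle))) = F x := by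
    intro x
    obtain ⟨v, hv⟩ := torusSection_coe_sub_int x
    rw [hv, hper]
  have key : ∀ c : Fin k → ℝ, ∫ x in unitBox c, F x
      = ∫ θ, F (torusSection k θ) ∂(volume : Measure (Fin k → UnitAddCircle)) := by
    intro c
    have hmp := measurePreserving_coe_unitBox c
    rw [← hmp.map_eq, integral_map (f := fun θ => F (torusSection k θ)) hmp.measurable.aemeasurable
      (hF.comp hσ).aestronglyMeasurable]
    refine integral_congr_ae (ae_of_all _ fun x => ?_)
    simp only [hfac]
  rw [key a, key b]

/-! ### The Weyl shift (Ford (6.1)) -/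

/-- Two sums of unimodular terms differ by at most the size of the symmetric difference of the
ranges. [folklore] -/
theorem norm_sum_sub_sum_le_card {ι : Type*} [DecidableEq ι] (A B : Finset ι) {g : ι → ℂ}
    (hg : ∀ i, ‖g i‖ ≤ 1) :
    ‖∑ i ∈ A, g i - ∑ i ∈ B, g i‖ ≤ (A \ B).card + (B \ A).card := by
  have hA : ∑ i ∈ A, g i = ∑ i ∈ A \ B, g i + ∑ i ∈ A ∩ B, g i := by
    rw [← Finset.sum_sdiff (Finset.inter_subset_left (s₁ := A) (s₂ := B)), sdiff_inter_self_left]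
  have hB : ∑ i ∈ B, g i = ∑ i ∈ B \ A, g i + ∑ i ∈ A ∩ B, g i := by
    rw [← Finset.sum_sdiff (Finset.inter_subset_right (s₁ := A) (s₂ := B)),
      sdiff_inter_self_right]
  rw [hA, hB, add_sub_add_right_eq_sub]
  refine (norm_sub_le _ _).trans (add_le_add ?_ ?_)
  · refine (norm_sum_le _ _).trans ?_
    have := Finset.sum_le_sum fun i (_ : i ∈ A \ B) => hg i
    simpa using this
  · refine (norm_sum_le _ _).trans ?_
    have := Finset.sum_le_sum fun i (_ : i ∈ B \ A) => hg i
    simpa using this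

/-- Reindexing `∑_{N < n ≤ R} F(n) = ∑_{N-m < n ≤ R-m} F(n+m)` (`m ≤ N ≤ R`). [folklore] -/
theorem sum_Ioc_eq_sum_Ioc_sub_add (F : ℕ → ℂ) {N R m : ℕ} (hm : m ≤ N) (hNR : N ≤ R) :
    ∑ n ∈ Ioc N R, F n = ∑ n ∈ Ioc (N - m) (R - m), F (n + m) := by
  have h := Finset.map_add_right_Ioc (N - m) (R - m) m
  rw [Nat.sub_add_cancel hm, Nat.sub_add_cancel (hm.trans hNR)] at h
  rw [← h, Finset.sum_map]
  rfl

/-- **The Weyl shift (Ford (6.1)).** For unimodularly bounded `F`, `N < R ≤ 2N` and `1 ≤ M ≤ N`: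
`‖∑_{N<n≤R} F(n)‖ ≤ M⁻¹ ∑_{N<n≤R-1} ‖∑_{1≤m≤⌊M⌋} F(n+m)‖ + N/M + M`.
[cite: Ford2002, (6.1)] -/
theorem weylShift {F : ℕ → ℂ} (hF : ∀ i, ‖F i‖ ≤ 1) {N R : ℕ} (hNR : N < R) (hR : R ≤ 2 * N)
    {M : ℝ} (hM : 1 ≤ M) (hMN : M ≤ N) :
    ‖∑ n ∈ Ioc N R, F n‖ ≤
      1 / M * ∑ n ∈ Ioc N (R - 1), ‖∑ m ∈ Icc 1 ⌊M⌋₊, F (n + m)‖ + N / M + M := by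
  set M' := ⌊M⌋₊ with hM'
  have hM0 : 0 < M := by linarith
  have hM'1 : 1 ≤ M' := Nat.le_floor (by simpa using hM)
  have hM'M : (M' : ℝ) ≤ M := Nat.floor_le hM0.le
  have hMlt : M < (M' : ℝ) + 1 := Nat.lt_floor_add_one M
  have hM'N : M' ≤ N := by
    have : (M' : ℝ) ≤ N := hM'M.trans hMN
    exact_mod_cast this
  set B := Ioc N (R - 1) with hB
  set T : ℕ → ℂ := fun n => ∑ m ∈ Icc 1 M', F (n + m) with hT
  -- the error of replacing the shifted range by `B`
  have herr : ∀ m ∈ Icc 1 M',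
      ‖∑ n ∈ Ioc N R, F n - ∑ n ∈ B, F (n + m)‖ ≤ 2 * m := by
    intro m hm
    rw [Finset.mem_Icc] at hm
    have hmN : m ≤ N := hm.2.trans hM'N
    rw [sum_Ioc_eq_sum_Ioc_sub_add F hmN hNR.le]
    refine (norm_sum_sub_sum_le_card (Ioc (N - m) (R - m)) B (g := fun n => F (n + m))
      (fun i => hF _)).trans ?_
    have h1 : (Ioc (N - m) (R - m) \ B).card ≤ m := by
      calc (Ioc (N - m) (R - m) \ B).card ≤ (Ioc (N - m) N).card := by
            refine Finset.card_le_card fun x hx => ?_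
            simp only [hB, Finset.mem_sdiff, Finset.mem_Ioc, not_and, not_le] at hx ⊢
            omega
        _ = m := by rw [Nat.card_Ioc]; omega
    have h2 : (B \ Ioc (N - m) (R - m)).card ≤ m := by
      calc (B \ Ioc (N - m) (R - m)).card ≤ (Ioc (R - m) (R - 1)).card := by
            refine Finset.card_le_card fun x hx => ?_
            simp only [hB, Finset.mem_sdiff, Finset.mem_Ioc, not_and, not_le] at hx ⊢
            omega
        _ ≤ m := by rw [Nat.card_Ioc]; omega
    have h1' : ((Ioc (N - m) (R - m) \ B).card : ℝ) ≤ m := by exact_mod_cast h1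
    have h2' : ((B \ Ioc (N - m) (R - m)).card : ℝ) ≤ m := by exact_mod_cast h2
    linarith
  -- averaging identity: (M'+1) S = ∑_{m ≤ M'} S + S
  set S := ∑ n ∈ Ioc N R, F n with hS
  have hS_le : ‖S‖ ≤ N := by
    refine (norm_sum_le _ _).trans ?_
    calc ∑ n ∈ Ioc N R, ‖F n‖ ≤ ∑ n ∈ Ioc N R, (1 : ℝ) := Finset.sum_le_sum fun i _ => hF i
      _ = (R - N : ℕ) := by simp
      _ ≤ N := by
          have : R - N ≤ N := by omega
          exact_mod_cast this
  have hmain : ‖(M' : ℂ) * S - ∑ n ∈ B, T n‖ ≤ (M' : ℝ) * (M' + 1) := by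
    have hTsum : ∑ n ∈ B, T n = ∑ m ∈ Icc 1 M', ∑ n ∈ B, F (n + m) := by
      rw [hT]; exact Finset.sum_comm
    have hMS : (M' : ℂ) * S = ∑ m ∈ Icc 1 M', S := by
      rw [Finset.sum_const, Nat.card_Icc, Nat.add_sub_cancel, nsmul_eq_mul]
    rw [hTsum, hMS, ← Finset.sum_sub_distrib]
    refine (norm_sum_le _ _).trans ?_
    calc ∑ m ∈ Icc 1 M', ‖S - ∑ n ∈ B, F (n + m)‖ ≤ ∑ m ∈ Icc 1 M', (2 * m : ℝ) :=
          Finset.sum_le_sum fun m hm => herr m hm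
      _ = 2 * ∑ m ∈ range (M' + 1), (m : ℝ) := by
          rw [Finset.mul_sum, Finset.range_eq_Ico]
          have : Icc 1 M' = Ico 1 (M' + 1) := rfl
          rw [this, Finset.sum_Ico_eq_sub _ (by omega : 1 ≤ M' + 1)]
          simp
      _ = (M' : ℝ) * (M' + 1) := by
          have := Finset.sum_range_id_mul_two (M' + 1)
          rw [Nat.add_sub_cancel] at this
          have h' : ((∑ i ∈ range (M' + 1), i : ℕ) : ℝ) * 2 = ((M' + 1) * M' : ℕ) := by
            exact_mod_cast this
          push_cast at h'
          nlinarith [h']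
  -- combine
  have hsumT : ‖∑ n ∈ B, T n‖ ≤ ∑ n ∈ B, ‖T n‖ := norm_sum_le _ _
  have hL : ‖((M' : ℂ) + 1) * S‖ ≤ ∑ n ∈ B, ‖T n‖ + (M' : ℝ) * (M' + 1) + N := by
    have : ((M' : ℂ) + 1) * S = ((M' : ℂ) * S - ∑ n ∈ B, T n) + ∑ n ∈ B, T n + S := by ring
    rw [this]
    refine (norm_add_le _ _).trans (add_le_add ((norm_add_le _ _).trans (add_le_add hmain hsumT))
      hS_le) |>.trans ?_
    linarith
  have hL' : ((M' : ℝ) + 1) * ‖S‖ ≤ ∑ n ∈ B, ‖T n‖ + (M' : ℝ) * (M' + 1) + N := by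
    have : ‖((M' : ℂ) + 1) * S‖ = ((M' : ℝ) + 1) * ‖S‖ := by
      rw [norm_mul]; congr 1
      have : ((M' : ℂ) + 1) = (((M' : ℝ) + 1 : ℝ) : ℂ) := by push_cast; ring
      rw [this, Complex.norm_real, Real.norm_eq_abs, abs_of_pos (by positivity)]
    rw [← this]; exact hL
  have hLpos : 0 < (M' : ℝ) + 1 := by positivity
  have hsum0 : 0 ≤ ∑ n ∈ B, ‖T n‖ := Finset.sum_nonneg fun _ _ => norm_nonneg _
  -- divide by M'+1 and compare with M
  have step : ‖S‖ ≤ (1 / ((M' : ℝ) + 1)) * ∑ n ∈ B, ‖T n‖ + M' + N / ((M' : ℝ) + 1) := by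
    rw [div_eq_mul_one_div (N : ℝ), mul_comm (N : ℝ)]
    have := div_le_div_of_nonneg_right hL' hLpos.le
    rw [mul_div_assoc] at this
    have h3 : ((M' : ℝ) + 1) * ‖S‖ / ((M' : ℝ) + 1) = ‖S‖ := by field_simp
    calc ‖S‖ = ((M' : ℝ) + 1) * ‖S‖ / ((M' : ℝ) + 1) := h3.symm
      _ ≤ (∑ n ∈ B, ‖T n‖ + (M' : ℝ) * (M' + 1) + N) / ((M' : ℝ) + 1) :=
          div_le_div_of_nonneg_right hL' hLpos.le
      _ = _ := by field_simp
  have h1M : 1 / ((M' : ℝ) + 1) ≤ 1 / M := one_div_le_one_div_of_le hM0 hMlt.le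
  calc ‖S‖ ≤ (1 / ((M' : ℝ) + 1)) * ∑ n ∈ B, ‖T n‖ + M' + N / ((M' : ℝ) + 1) := step
    _ ≤ 1 / M * ∑ n ∈ B, ‖T n‖ + M + N / M := by
        have hNdiv : (N : ℝ) / ((M' : ℝ) + 1) ≤ N / M :=
          div_le_div_of_nonneg_left (Nat.cast_nonneg N) hM0 hMlt.le
        nlinarith [mul_le_mul_of_nonneg_right h1M hsum0]
    _ = _ := by ring


/-! ### The phase `-(t/2π) log(1 + w/a)`, its Taylor polynomial and the remainder -/

/-- `γ_j = (-1)^j t/(2π j a^j)` (`j = 1, …, k`, here indexed by `Fin k`, `j ↦ j + 1`): the Taylor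
coefficients of `-(t/2π) log(1 + w/a)` at `w = 0`. [cite: Ford2002, proof of Lemma 6.3] -/
def gam (t a : ℝ) (k : ℕ) (j : Fin k) : ℝ := t / (2 * π * (j.val + 1)) * (-1 / a) ^ (j.val + 1)

/-- The polynomial `P_β(w) = ∑_j β_j w^j` (`j = 1, …, k`). [folklore] -/
def poly {k : ℕ} (β : Fin k → ℝ) (w : ℝ) : ℝ := ∑ j, β j * w ^ (j.val + 1)

/-- The remainder phase `φ(w) = -(t/2π) log(1 + w/a) - P_β(w)`. [cite: Ford2002, proof of Lemma 6.3] -/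
def phi (t a : ℝ) {k : ℕ} (β : Fin k → ℝ) (w : ℝ) : ℝ :=
  -(t / (2 * π)) * Real.log (1 + w / a) - poly β w

/-- `φ'(w) = -(t/2π)/(a + w) - ∑_j j β_j w^{j-1}`. [cite: Ford2002, (6.8)] -/
def phi' (t a : ℝ) {k : ℕ} (β : Fin k → ℝ) (w : ℝ) : ℝ :=
  -(t / (2 * π)) / (a + w) - ∑ j, β j * ((j.val + 1) * w ^ j.val)

/-- `φ` has derivative `φ'` (`a > 0`, `w ≥ 0`). [folklore] -/
theorem hasDerivAt_phi (t : ℝ) {a : ℝ} (ha : 0 < a) {k : ℕ} (β : Fin k → ℝ) {w : ℝ}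
    (hw : 0 ≤ w) : HasDerivAt (phi t a β) (phi' t a β w) w := by
  have h1 : HasDerivAt (fun w : ℝ => 1 + w / a) (1 / a) w := by
    simpa using ((hasDerivAt_id w).div_const a).const_add 1
  have hpos : 0 < 1 + w / a := by positivity
  have h2 : HasDerivAt (fun w : ℝ => Real.log (1 + w / a)) ((1 / a) / (1 + w / a)) w :=
    h1.log hpos.ne'
  have h3 : HasDerivAt (fun w : ℝ => poly β w)
      (∑ j : Fin k, β j * (((j.val + 1 : ℕ) : ℝ) * w ^ (j.val + 1 - 1))) w := by
    unfold poly
    exact HasDerivAt.fun_sum fun j _ => (hasDerivAt_pow (j.val + 1) w).const_mul (β j)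
  have h4 := (h2.const_mul (-(t / (2 * π)))).fun_sub h3
  have key : -(t / (2 * π)) * (1 / a / (1 + w / a))
      - ∑ j : Fin k, β j * (((j.val + 1 : ℕ) : ℝ) * w ^ (j.val + 1 - 1)) = phi' t a β w := by
    unfold phi'
    congr 1
    · field_simp
    · refine Finset.sum_congr rfl fun j _ => ?_
      simp
  rw [← key]
  exact h4

/-- The Taylor coefficients sum the geometric series:
`-(t/2π)/(a+w) - ∑_j j γ_j w^{j-1} = -(t/2π) (-w/a)^k/(a+w)`. [cite: Ford2002, (5.1)] -/
theorem taylor_identity (t : ℝ) {a : ℝ} (ha : 0 < a) (k : ℕ) {w : ℝ} (hw : 0 ≤ w) :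
    -(t / (2 * π)) / (a + w) - ∑ j : Fin k, gam t a k j * ((j.val + 1) * w ^ j.val)
      = -(t / (2 * π)) * (-w / a) ^ k / (a + w) := by
  have haw : 0 < a + w := by linarith
  obtain ⟨x, hx⟩ : ∃ x : ℝ, -w / a = x := ⟨_, rfl⟩
  have hterm : ∀ j : Fin k, gam t a k j * ((j.val + 1) * w ^ j.val)
      = -(t / (2 * π * a)) * x ^ j.val := by
    intro j
    unfold gam
    have hj : (j.val : ℝ) + 1 ≠ 0 := by positivity
    rw [← hx, show (-w / a) = (-1 / a) * w by ring, mul_pow, pow_succ]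
    field_simp
  have hsum : ∑ j : Fin k, gam t a k j * ((j.val + 1) * w ^ j.val)
      = -(t / (2 * π * a)) * ∑ j ∈ range k, x ^ j := by
    rw [Finset.mul_sum, ← Fin.sum_univ_eq_sum_range]
    exact Finset.sum_congr rfl fun j _ => hterm j
  have hG := geom_sum_mul_neg x k
  obtain ⟨G, hGdef⟩ : ∃ G : ℝ, ∑ j ∈ range k, x ^ j = G := ⟨_, rfl⟩
  rw [hGdef] at hsum hG
  have h1x : (1 : ℝ) - x = (a + w) / a := by rw [← hx]; field_simp; ring
  rw [h1x] at hG
  have hG' : G = a * (1 - x ^ k) / (a + w) := by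
    rw [eq_div_iff haw.ne']
    field_simp at hG
    linarith [hG]
  rw [hsum, hx, hG']
  field_simp
  ring

/-- **The remainder has small derivative** (Ford (6.8)): for `a > 0`, `0 ≤ w`,
`|φ'(w)| ≤ (t/2π) w^k/a^{k+1} + ∑_j j |β_j - γ_j| w^{j-1}`. [cite: Ford2002, (6.8)] -/
theorem abs_phi'_le {t a : ℝ} (ht : 0 ≤ t) (ha : 0 < a) {k : ℕ} (β : Fin k → ℝ) {w : ℝ}
    (hw : 0 ≤ w) :
    |phi' t a β w| ≤ t / (2 * π) * w ^ k / a ^ (k + 1)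
      + ∑ j : Fin k, (j.val + 1) * |β j - gam t a k j| * w ^ j.val := by
  have haw : 0 < a + w := by linarith
  have hsplit : phi' t a β w
      = -(t / (2 * π)) * (-w / a) ^ k / (a + w)
        - ∑ j : Fin k, (β j - gam t a k j) * ((j.val + 1) * w ^ j.val) := by
    rw [← taylor_identity t ha k hw]
    unfold phi'
    simp only [sub_mul, Finset.sum_sub_distrib]
    ring
  rw [hsplit]
  refine (abs_sub _ _).trans (add_le_add ?_ ?_)
  · rw [abs_div, abs_mul, abs_of_pos haw, abs_neg, abs_of_nonneg (by positivity : 0 ≤ t / (2 * π)),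
      abs_pow, abs_div, abs_neg, abs_of_nonneg hw, abs_of_pos ha]
    rw [div_pow, mul_div_assoc, mul_div_assoc]
    refine mul_le_mul_of_nonneg_left ?_ (by positivity)
    rw [div_div, pow_succ]
    exact div_le_div_of_nonneg_left (by positivity) (by positivity)
      (mul_le_mul_of_nonneg_left (by linarith) (by positivity))
  · refine (Finset.abs_sum_le_sum_abs _ _).trans (le_of_eq (Finset.sum_congr rfl fun j _ => ?_))
    rw [abs_mul, abs_mul, abs_of_nonneg (by positivity : (0 : ℝ) ≤ j.val + 1), abs_pow,
      abs_of_nonneg hw]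
    ring

/-- `δ_j = 1/(2π j k M^j)` (`j = 1, …, k`): the half-widths of the box `Ω_n`.
[cite: Ford2002, proof of Lemma 6.3] -/
def del (M : ℝ) (k : ℕ) (j : Fin k) : ℝ := 1 / (2 * π * (j.val + 1) * k * M ^ (j.val + 1))

/-- `δ_j > 0`. [folklore] -/
theorem del_pos {M : ℝ} (hM : 0 < M) {k : ℕ} (j : Fin k) : 0 < del M k j := by
  unfold del
  have hk : (0 : ℝ) < k := by
    have := j.isLt
    exact_mod_cast (Nat.zero_le _).trans_lt this
  positivity

/-- **`|φ'| ≤ 1/(πM)` on `[0, M]`** when `|β_j - γ_j| ≤ δ_j` for all `j`, `t M^{k+1} ≤ N^{k+1}` and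
`a > N`. [cite: Ford2002, proof of Lemma 6.3, after (6.8)] -/
theorem abs_phi'_le_inv {t a M : ℝ} {N k : ℕ} (hk : 1 ≤ k) (ht : 0 ≤ t) (hN : 0 < N)
    (haN : (N : ℝ) ≤ a) (hM : 0 < M) (htM : t * M ^ (k + 1) ≤ (N : ℝ) ^ (k + 1))
    {β : Fin k → ℝ} (hβ : ∀ j, |β j - gam t a k j| ≤ del M k j) {w : ℝ} (hw0 : 0 ≤ w)
    (hwM : w ≤ M) : |phi' t a β w| ≤ 1 / (π * M) := by
  have ha : 0 < a := lt_of_lt_of_le (by exact_mod_cast hN) haN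
  have hkpos : (0 : ℝ) < k := by exact_mod_cast hk
  refine (abs_phi'_le ht ha β hw0).trans ?_
  have h1 : t / (2 * π) * w ^ k / a ^ (k + 1) ≤ 1 / (2 * π * M) := by
    have hwk : w ^ k ≤ M ^ k := pow_le_pow_left₀ hw0 hwM k
    have hak : (N : ℝ) ^ (k + 1) ≤ a ^ (k + 1) := pow_le_pow_left₀ (by positivity) haN _
    calc t / (2 * π) * w ^ k / a ^ (k + 1) ≤ t / (2 * π) * M ^ k / (N : ℝ) ^ (k + 1) := by
          gcongr
      _ = (t * M ^ (k + 1)) / (N : ℝ) ^ (k + 1) * (1 / (2 * π * M)) := by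
          field_simp; ring
      _ ≤ 1 * (1 / (2 * π * M)) := by
          gcongr
          rwa [div_le_one (by positivity)]
      _ = 1 / (2 * π * M) := one_mul _
  have h2 : ∑ j : Fin k, (j.val + 1) * |β j - gam t a k j| * w ^ j.val
      ≤ ∑ _j : Fin k, 1 / (2 * π * k * M) := by
    refine Finset.sum_le_sum fun j _ => ?_
    have hwj : w ^ j.val ≤ M ^ j.val := pow_le_pow_left₀ hw0 hwM _
    calc (j.val + 1) * |β j - gam t a k j| * w ^ j.val
        ≤ (j.val + 1) * del M k j * w ^ j.val := by
          gcongr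
          exact hβ j
      _ ≤ (j.val + 1) * del M k j * M ^ j.val :=
          mul_le_mul_of_nonneg_left hwj (mul_nonneg (by positivity) (del_pos hM j).le)
      _ = 1 / (2 * π * k * M) := by
          unfold del
          have hj : (j.val : ℝ) + 1 ≠ 0 := by positivity
          field_simp
          ring
  have h3 : ∑ _j : Fin k, 1 / (2 * π * k * M) = 1 / (2 * π * M) := by
    rw [Finset.sum_const, Finset.card_univ, Fintype.card_fin, nsmul_eq_mul]
    field_simp
  calc _ ≤ 1 / (2 * π * M) + 1 / (2 * π * M) := add_le_add h1 (h2.trans h3.le)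
    _ = 1 / (π * M) := by field_simp; ring

/-- Consecutive values of `φ` differ by at most `1/(πM)` on `[0, M]`. [folklore] -/
theorem abs_phi_sub_phi_le {t a M : ℝ} {N k : ℕ} (hk : 1 ≤ k) (ht : 0 ≤ t) (hN : 0 < N)
    (haN : (N : ℝ) ≤ a) (hM : 0 < M) (htM : t * M ^ (k + 1) ≤ (N : ℝ) ^ (k + 1))
    {β : Fin k → ℝ} (hβ : ∀ j, |β j - gam t a k j| ≤ del M k j) {x y : ℝ} (hx0 : 0 ≤ x)
    (hxM : x ≤ M) (hy0 : 0 ≤ y) (hyM : y ≤ M) :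
    |phi t a β y - phi t a β x| ≤ 1 / (π * M) * |y - x| := by
  have ha : 0 < a := lt_of_lt_of_le (by exact_mod_cast hN) haN
  have hconv : Convex ℝ (Set.Icc (0 : ℝ) M) := convex_Icc 0 M
  have hderiv : ∀ z ∈ Set.Icc (0 : ℝ) M,
      HasDerivWithinAt (phi t a β) (phi' t a β z) (Set.Icc (0 : ℝ) M) z :=
    fun z hz => (hasDerivAt_phi t ha β hz.1).hasDerivWithinAt
  have hbound : ∀ z ∈ Set.Icc (0 : ℝ) M, ‖phi' t a β z‖ ≤ 1 / (π * M) := fun z hz => by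
    rw [Real.norm_eq_abs]; exact abs_phi'_le_inv hk ht hN haN hM htM hβ hz.1 hz.2
  have := hconv.norm_image_sub_le_of_norm_hasDerivWithin_le hderiv hbound ⟨hx0, hxM⟩ ⟨hy0, hyM⟩
  simpa only [Real.norm_eq_abs] using this

/-! ### Summation by parts: `|T(n)| ≤ S₀(β)` on the box `Ω_n` -/

/-- `e` is `2π`-Lipschitz. [folklore] -/
theorem norm_e_sub_e_le (x y : ℝ) : ‖e x - e y‖ ≤ 2 * π * |x - y| := by
  have h1 : e x - e y = e y * (e (x - y) - 1) := by
    rw [mul_sub, mul_one, ← e_add]; ring_nf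
  rw [h1, norm_mul, norm_e, one_mul]
  have h2 : e (x - y) = Complex.exp (Complex.I * ((2 * π * (x - y) : ℝ) : ℂ)) := by
    rw [e, mul_comm]
  rw [h2]
  refine (Real.norm_exp_I_mul_ofReal_sub_one_le).trans (le_of_eq ?_)
  rw [Real.norm_eq_abs, abs_mul, abs_of_pos (by positivity : (0 : ℝ) < 2 * π)]

/-- Abel's summation by parts for `∑_{1 ≤ m ≤ L} c_m b_m` with the partial sums
`A_m = ∑_{1 ≤ i ≤ m} c_i`. [folklore] -/
theorem sum_Icc_mul_eq_parts (c b : ℕ → ℂ) (L : ℕ) :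
    ∑ m ∈ Icc 1 L, c m * b m
      = (∑ i ∈ Icc 1 L, c i) * b L
        + ∑ m ∈ Ico 1 L, (∑ i ∈ Icc 1 m, c i) * (b m - b (m + 1)) := by
  induction L with
  | zero => simp
  | succ L ih =>
    rw [Finset.sum_Icc_succ_top (by omega), ih, Finset.sum_Icc_succ_top (by omega)]
    rcases Nat.eq_zero_or_pos L with hL | hL
    · subst hL; simp
    · rw [Finset.sum_Ico_succ_top hL]
      ring

/-- The bound from summation by parts: if `‖b_m‖ ≤ 1` and `‖b_m - b_{m+1}‖ ≤ η` (`1 ≤ m < L`), then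
`‖∑_{m ≤ L} c_m b_m‖ ≤ ‖A_L‖ + η ∑_{m < L} ‖A_m‖`. [folklore] -/
theorem norm_sum_Icc_mul_le (c b : ℕ → ℂ) (L : ℕ) {η : ℝ} (hb : ∀ m, ‖b m‖ ≤ 1)
    (hdb : ∀ m ∈ Ico 1 L, ‖b m - b (m + 1)‖ ≤ η) :
    ‖∑ m ∈ Icc 1 L, c m * b m‖
      ≤ ‖∑ i ∈ Icc 1 L, c i‖ + η * ∑ m ∈ Ico 1 L, ‖∑ i ∈ Icc 1 m, c i‖ := by
  rw [sum_Icc_mul_eq_parts]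
  refine (norm_add_le _ _).trans (add_le_add ?_ ?_)
  · rw [norm_mul]
    exact (mul_le_mul_of_nonneg_left (hb L) (norm_nonneg _)).trans (le_of_eq (mul_one _))
  · refine (norm_sum_le _ _).trans ?_
    rw [Finset.mul_sum]
    refine Finset.sum_le_sum fun m hm => ?_
    rw [norm_mul, mul_comm]
    exact mul_le_mul_of_nonneg_right (hdb m hm) (norm_nonneg _)


/-- The partial sums `A_m(β) = ∑_{1 ≤ x ≤ m} e(β₁x + ⋯ + β_k x^k)` of the Vinogradov polynomial.
[cite: Ford2002, proof of Lemma 6.3 (`S(w;β)`)] -/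
def Spart (k : ℕ) (β : Fin k → ℝ) (m : ℕ) : ℂ := ∑ i ∈ Icc 1 m, E (nu k (i : ℤ)) β

/-- `A_m(β)` is the trigonometric polynomial `tp [1, m]` of `VinogradovTorus`. [folklore] -/
theorem Spart_eq_tp (k : ℕ) (β : Fin k → ℝ) (m : ℕ) :
    Spart k β m = tp (Finset.Icc (1 : ℤ) m) (nu k) β := by
  unfold Spart tp
  rw [show (1 : ℤ) = ((1 : ℕ) : ℤ) by simp, VdC.sum_Icc_int_eq_nat]

/-- `e(α · ν(m)) = e(P_α(m))`. [folklore] -/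
theorem E_nu_eq_e_poly (k : ℕ) (β : Fin k → ℝ) (m : ℤ) : E (nu k m) β = e (poly β m) := by
  rw [E_eq_e_sum]
  unfold poly nu
  congr 1
  refine Finset.sum_congr rfl fun j _ => ?_
  push_cast
  ring

/-- `A_m(β)` is continuous in `β`. [folklore] -/
theorem continuous_Spart (k : ℕ) (m : ℕ) : Continuous fun β : Fin k → ℝ => Spart k β m := by
  unfold Spart
  exact continuous_finsetSum _ fun i _ => continuous_E _

/-- `A_m(β + v) = A_m(β)` for `v ∈ ℤ^k`. [folklore] -/
theorem Spart_add_int (k : ℕ) (β : Fin k → ℝ) (v : Fin k → ℤ) (m : ℕ) :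
    Spart k (fun j => β j + v j) m = Spart k β m := by
  unfold Spart
  refine Finset.sum_congr rfl fun i _ => ?_
  unfold E
  refine Finset.prod_congr rfl fun j _ => ?_
  rw [mul_add, e_add, show ((nu k (i : ℤ) j : ℤ) : ℝ) * (v j : ℝ) = ((nu k (i : ℤ) j * v j : ℤ) : ℝ) by
    push_cast; ring, e_int, mul_one]

/-- `S₀(β) = |A_{M'}(β)| + (2/M) ∑_{1 ≤ m < M'} |A_m(β)|` (`M' = ⌊M⌋`), the majorant from
summation by parts. [cite: Ford2002, proof of Lemma 6.3 (`S₀(β)`)] -/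
def S0 (k : ℕ) (M : ℝ) (β : Fin k → ℝ) : ℝ :=
  ‖Spart k β ⌊M⌋₊‖ + 2 / M * ∑ m ∈ Ico 1 ⌊M⌋₊, ‖Spart k β m‖

/-- `S₀ ≥ 0` (`M ≥ 0`). [folklore] -/
theorem S0_nonneg (k : ℕ) {M : ℝ} (hM : 0 ≤ M) (β : Fin k → ℝ) : 0 ≤ S0 k M β := by
  unfold S0
  have : 0 ≤ ∑ m ∈ Ico 1 ⌊M⌋₊, ‖Spart k β m‖ := Finset.sum_nonneg fun _ _ => norm_nonneg _
  positivity

/-- `S₀` is continuous. [folklore] -/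
theorem continuous_S0 (k : ℕ) (M : ℝ) : Continuous (S0 k M) := by
  unfold S0
  refine ((continuous_Spart k _).norm).add (continuous_const.mul ?_)
  exact continuous_finsetSum _ fun m _ => (continuous_Spart k m).norm

/-- `S₀(β + v) = S₀(β)` for `v ∈ ℤ^k`. [folklore] -/
theorem S0_add_int (k : ℕ) (M : ℝ) (β : Fin k → ℝ) (v : Fin k → ℤ) :
    S0 k M (fun j => β j + v j) = S0 k M β := by
  unfold S0
  simp_rw [Spart_add_int]

/-- The sum `T(n) = ∑_{1 ≤ m ≤ ⌊M⌋} e(-(t/2π) log(1 + m/a))` (`a = n + u`).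
[cite: Ford2002, proof of Lemma 6.3 (`T(n)`)] -/
def Tsum (t a M : ℝ) : ℂ := ∑ m ∈ Icc 1 ⌊M⌋₊, e (-(t / (2 * π)) * Real.log (1 + m / a))

/-- **`|T(n)| ≤ S₀(β)` for every `β` in the box `Ω_n`** (`|β_j - γ_j| ≤ δ_j`), by summation by
parts with `|φ'| ≤ 1/(πM)`. [cite: Ford2002, proof of Lemma 6.3] -/
theorem norm_Tsum_le_S0 {t a M : ℝ} {N k : ℕ} (hk : 1 ≤ k) (ht : 0 ≤ t) (hN : 0 < N)
    (haN : (N : ℝ) ≤ a) (hM : 1 ≤ M) (htM : t * M ^ (k + 1) ≤ (N : ℝ) ^ (k + 1))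
    {β : Fin k → ℝ} (hβ : ∀ j, |β j - gam t a k j| ≤ del M k j) :
    ‖Tsum t a M‖ ≤ S0 k M β := by
  have hM0 : 0 < M := by linarith
  have ha : 0 < a := lt_of_lt_of_le (by exact_mod_cast hN) haN
  set M' := ⌊M⌋₊ with hM'
  have hM'M : (M' : ℝ) ≤ M := Nat.floor_le hM0.le
  -- write the terms as `c_m b_m`
  set c : ℕ → ℂ := fun m => E (nu k (m : ℤ)) β with hc
  set b : ℕ → ℂ := fun m => e (phi t a β m) with hb
  have hterm : ∀ m : ℕ, e (-(t / (2 * π)) * Real.log (1 + m / a)) = c m * b m := by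
    intro m
    rw [hc, hb]
    simp only
    rw [E_nu_eq_e_poly, ← e_add]
    congr 1
    unfold phi
    push_cast
    ring
  have hT : Tsum t a M = ∑ m ∈ Icc 1 M', c m * b m := by
    unfold Tsum
    exact Finset.sum_congr rfl fun m _ => hterm m
  rw [hT]
  have hb1 : ∀ m, ‖b m‖ ≤ 1 := fun m => by rw [hb]; exact (norm_e _).le
  have hdb : ∀ m ∈ Ico 1 M', ‖b m - b (m + 1)‖ ≤ 2 / M := by
    intro m hm
    rw [Finset.mem_Ico] at hm
    have hm1 : ((m + 1 : ℕ) : ℝ) ≤ M := le_trans (by exact_mod_cast hm.2) hM'M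
    have hm0 : (0 : ℝ) ≤ m := Nat.cast_nonneg m
    rw [hb]
    refine (norm_e_sub_e_le _ _).trans ?_
    have := abs_phi_sub_phi_le hk ht hN haN hM0 htM hβ (x := ((m + 1 : ℕ) : ℝ)) (y := (m : ℝ))
      (by positivity) hm1 hm0 (by push_cast at hm1 ⊢; linarith)
    rw [show |(m : ℝ) - ((m + 1 : ℕ) : ℝ)| = 1 by push_cast; rw [abs_of_nonpos (by linarith)]; ring]
      at this
    calc 2 * π * |phi t a β m - phi t a β ((m + 1 : ℕ) : ℝ)| ≤ 2 * π * (1 / (π * M) * 1) := by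
          gcongr
      _ = 2 / M := by field_simp
  have := norm_sum_Icc_mul_le c b M' hb1 hdb
  unfold S0 Spart
  exact this

/-! ### The box `Ω_n` and the average bound `|T(n)|^{2s} |Ω_n| ≤ ∫_{Ω_n} S₀^{2s}` -/

/-- The box `Ω_n = ∏_j [γ_j - δ_j, γ_j + δ_j]`. [cite: Ford2002, proof of Lemma 6.3 (`Ω_n`)] -/
def Omega (t a M : ℝ) (k : ℕ) : Set (Fin k → ℝ) :=
  Set.Icc (fun j => gam t a k j - del M k j) (fun j => gam t a k j + del M k j)

/-- Membership in `Ω_n`. [folklore] -/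
theorem mem_Omega {t a M : ℝ} {k : ℕ} {β : Fin k → ℝ} :
    β ∈ Omega t a M k ↔ ∀ j, |β j - gam t a k j| ≤ del M k j := by
  unfold Omega
  rw [Set.mem_Icc, Pi.le_def, Pi.le_def, ← forall_and]
  refine forall_congr' fun j => ?_
  rw [abs_sub_le_iff]
  constructor
  · rintro ⟨h1, h2⟩; constructor <;> linarith
  · rintro ⟨h1, h2⟩; constructor <;> linarith

/-- `|Ω_n| = ∏_j 2δ_j`. [folklore] -/
theorem volume_Omega_toReal {t a M : ℝ} (hM : 0 < M) (k : ℕ) :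
    (volume (Omega t a M k)).toReal = ∏ j : Fin k, (2 * del M k j) := by
  unfold Omega
  rw [Real.volume_Icc_pi_toReal]
  · refine Finset.prod_congr rfl fun j _ => ?_
    ring
  · intro j
    have := del_pos hM j
    simp only
    linarith

/-- `Ω_n` has finite volume. [folklore] -/
theorem volume_Omega_lt_top (t a M : ℝ) (k : ℕ) : volume (Omega t a M k) < ⊤ := by
  unfold Omega
  exact measure_Icc_lt_top

/-- **The average bound**: `|T(n)|^{2s} ∏_j 2δ_j ≤ ∫_{Ω_n} S₀(β)^{2s} dβ`.
[cite: Ford2002, proof of Lemma 6.3] -/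
theorem norm_Tsum_pow_mul_le_integral {t a M : ℝ} {N k : ℕ} (hk : 1 ≤ k) (ht : 0 ≤ t)
    (hN : 0 < N) (haN : (N : ℝ) ≤ a) (hM : 1 ≤ M) (htM : t * M ^ (k + 1) ≤ (N : ℝ) ^ (k + 1))
    (s : ℕ) :
    ‖Tsum t a M‖ ^ (2 * s) * ∏ j : Fin k, (2 * del M k j)
      ≤ ∫ β in Omega t a M k, S0 k M β ^ (2 * s) := by
  have hM0 : 0 < M := by linarith
  rw [← volume_Omega_toReal hM0 k, mul_comm]
  have hconst : ∫ _β in Omega t a M k, ‖Tsum t a M‖ ^ (2 * s)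
      = (volume (Omega t a M k)).toReal * ‖Tsum t a M‖ ^ (2 * s) := by
    rw [setIntegral_const, smul_eq_mul, measureReal_def]
  rw [← hconst]
  refine setIntegral_mono_on ?_ ?_ measurableSet_Icc fun β hβ => ?_
  · exact integrableOn_const (volume_Omega_lt_top t a M k).ne
  · exact ((continuous_S0 k M).pow _).continuousOn.integrableOn_compact isCompact_Icc
  · exact pow_le_pow_left₀ (norm_nonneg _) (norm_Tsum_le_S0 hk ht hN haN hM htM (mem_Omega.1 hβ)) _


/-! ### The periodized indicator of the last coordinate and the count `≤ W` -/

/-- The points of `ℝ` within `δ` of `c + ℤ`. [folklore] -/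
def nearSet (c δ : ℝ) : Set ℝ := ⋃ v : ℤ, Set.Icc (c + v - δ) (c + v + δ)

/-- `nearSet` is measurable. [folklore] -/
theorem measurableSet_nearSet (c δ : ℝ) : MeasurableSet (nearSet c δ) :=
  MeasurableSet.iUnion fun _ => measurableSet_Icc

/-- Membership in `nearSet`. [folklore] -/
theorem mem_nearSet_iff {c δ x : ℝ} : x ∈ nearSet c δ ↔ ∃ v : ℤ, |x - c - v| ≤ δ := by
  unfold nearSet
  simp only [Set.mem_iUnion, Set.mem_Icc, abs_sub_le_iff]
  constructor
  · rintro ⟨v, h1, h2⟩; exact ⟨v, by linarith, by linarith⟩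
  · rintro ⟨v, h1, h2⟩; exact ⟨v, by linarith, by linarith⟩

/-- Points within `δ` of `c` itself are in `nearSet c δ`. [folklore] -/
theorem mem_nearSet_of_abs_le {c δ x : ℝ} (h : |x - c| ≤ δ) : x ∈ nearSet c δ :=
  mem_nearSet_iff.2 ⟨0, by simpa using h⟩

/-- `nearSet c δ` is invariant under integer shifts. [folklore] -/
theorem add_int_mem_nearSet_iff {c δ x : ℝ} (w : ℤ) : x + w ∈ nearSet c δ ↔ x ∈ nearSet c δ := by
  rw [mem_nearSet_iff, mem_nearSet_iff]
  constructor
  · rintro ⟨v, hv⟩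
    refine ⟨v - w, ?_⟩
    rw [show x - c - ((v - w : ℤ) : ℝ) = x + w - c - v by push_cast; ring]
    exact hv
  · rintro ⟨v, hv⟩
    refine ⟨v + w, ?_⟩
    rw [show x + w - c - ((v + w : ℤ) : ℝ) = x - c - v by push_cast; ring]
    exact hv

/-- The periodized indicator `χ_{c,δ}` of `[c - δ, c + δ] + ℤ`. [folklore] -/
def chi (c δ : ℝ) : ℝ → ℝ := (nearSet c δ).indicator 1

/-- `χ` is measurable. [folklore] -/
theorem measurable_chi (c δ : ℝ) : Measurable (chi c δ) :=
  measurable_one.indicator (measurableSet_nearSet c δ)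

open Classical in
/-- `χ` as an `if`. [folklore] -/
theorem chi_apply (c δ x : ℝ) : chi c δ x = if x ∈ nearSet c δ then 1 else 0 := by
  unfold chi; rw [Set.indicator_apply]; rfl

/-- `0 ≤ χ ≤ 1`. [folklore] -/
theorem chi_nonneg (c δ x : ℝ) : 0 ≤ chi c δ x := by
  rw [chi_apply]; split_ifs <;> norm_num

/-- `χ ≤ 1`. [folklore] -/
theorem chi_le_one (c δ x : ℝ) : chi c δ x ≤ 1 := by
  rw [chi_apply]; split_ifs <;> norm_num

/-- `χ` is `ℤ`-periodic. [folklore] -/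
theorem chi_add_int (c δ x : ℝ) (w : ℤ) : chi c δ (x + w) = chi c δ x := by
  rw [chi_apply, chi_apply]
  by_cases h : x ∈ nearSet c δ
  · rw [if_pos h, if_pos ((add_int_mem_nearSet_iff w).2 h)]
  · rw [if_neg h, if_neg (mt (add_int_mem_nearSet_iff w).1 h)]

/-- `χ = 1` on `[c - δ, c + δ]`. [folklore] -/
theorem chi_eq_one_of_abs_le {c δ x : ℝ} (h : |x - c| ≤ δ) : chi c δ x = 1 := by
  rw [chi_apply, if_pos (mem_nearSet_of_abs_le h)]

/-- The last Taylor coefficient is small: `|γ_K(a)| < 1/(2πK)` when `t < a^K`.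
[cite: Ford2002, proof of Lemma 6.3 ("`|γ_k(N) - γ_k(2N)| < 1/2`")] -/
theorem abs_gam_last_lt {t a : ℝ} (ht : 0 ≤ t) (ha : 0 < a) (k : ℕ) (hta : t < a ^ (k + 1)) :
    |gam t a (k + 1) (Fin.last k)| < 1 / (2 * π * (k + 1)) := by
  unfold gam
  simp only [Fin.val_last]
  rw [abs_mul, abs_of_nonneg (by positivity : 0 ≤ t / (2 * π * ((k : ℝ) + 1))), abs_pow, abs_div,
    abs_neg, abs_one, abs_of_pos ha, one_div_pow]
  rw [div_mul_eq_mul_div, mul_one_div, div_div, div_lt_div_iff₀ (by positivity) (by positivity),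
    one_mul]
  calc t * (2 * π * (k + 1)) < a ^ (k + 1) * (2 * π * (k + 1)) := by gcongr

/-- Differences of the last Taylor coefficient: for `0 < a₁ ≤ a₂`,
`|γ_K(a₁) - γ_K(a₂)| = (t/2πK) (a₁^{-K} - a₂^{-K})`. [folklore] -/
theorem abs_gam_last_sub {t a₁ a₂ : ℝ} (ht : 0 ≤ t) (ha₁ : 0 < a₁) (h12 : a₁ ≤ a₂) (k : ℕ) :
    |gam t a₁ (k + 1) (Fin.last k) - gam t a₂ (k + 1) (Fin.last k)|
      = t / (2 * π * (k + 1)) * (1 / a₁ ^ (k + 1) - 1 / a₂ ^ (k + 1)) := by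
  have ha₂ : 0 < a₂ := lt_of_lt_of_le ha₁ h12
  unfold gam
  simp only [Fin.val_last]
  rw [← mul_sub, abs_mul, abs_of_nonneg (by positivity : 0 ≤ t / (2 * π * ((k : ℝ) + 1)))]
  congr 1
  rw [div_pow, div_pow, neg_one_pow_eq_pow_mod_two]
  have hle : 1 / a₂ ^ (k + 1) ≤ 1 / a₁ ^ (k + 1) :=
    one_div_le_one_div_of_le (by positivity) (pow_le_pow_left₀ ha₁.le h12 _)
  rcases Nat.mod_two_eq_zero_or_one (k + 1) with h | h
  · rw [h, pow_zero, abs_of_nonneg (by linarith)]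
  · rw [h, pow_one, show (-1 : ℝ) / a₁ ^ (k + 1) - -1 / a₂ ^ (k + 1)
        = -(1 / a₁ ^ (k + 1) - 1 / a₂ ^ (k + 1)) by ring, abs_neg, abs_of_nonneg (by linarith)]

/-- Spacing of inverse powers: `0 < a₁ ≤ a₂ ≤ L` gives
`a₁^{-K} - a₂^{-K} ≥ K (a₂ - a₁)/L^{K+1}`. [folklore] -/
theorem inv_pow_sub_inv_pow_ge {a₁ a₂ L : ℝ} (ha₁ : 0 < a₁) (h12 : a₁ ≤ a₂) (h2L : a₂ ≤ L)
    (K : ℕ) : (K : ℝ) * (a₂ - a₁) / L ^ (K + 1) ≤ 1 / a₁ ^ K - 1 / a₂ ^ K := by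
  have ha₂ : 0 < a₂ := lt_of_lt_of_le ha₁ h12
  have hL : 0 < L := lt_of_lt_of_le ha₂ h2L
  rcases Nat.eq_zero_or_pos K with hK | hK
  · subst hK; simp
  have hbin := pow_add_mul_le_add_pow ha₁.le (b := a₂ - a₁) (by linarith) K
  rw [add_sub_cancel] at hbin
  -- `a₂^K - a₁^K ≥ K a₁^{K-1} (a₂ - a₁)`
  have hdiff : (K : ℝ) * a₁ ^ (K - 1) * (a₂ - a₁) ≤ a₂ ^ K - a₁ ^ K := by linarith
  have hpow : a₁ ^ K = a₁ ^ (K - 1) * a₁ := by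
    rw [← pow_succ, Nat.sub_add_cancel hK]
  rw [div_sub_div _ _ (by positivity) (by positivity), one_mul, mul_one,
    div_le_div_iff₀ (by positivity) (by positivity)]
  calc (K : ℝ) * (a₂ - a₁) * (a₁ ^ K * a₂ ^ K)
      = ((K : ℝ) * a₁ ^ (K - 1) * (a₂ - a₁)) * (a₁ * a₂ ^ K) := by rw [hpow]; ring
    _ ≤ (a₂ ^ K - a₁ ^ K) * (a₁ * a₂ ^ K) := by gcongr
    _ ≤ (a₂ ^ K - a₁ ^ K) * L ^ (K + 1) := by
        have h0 : 0 ≤ a₂ ^ K - a₁ ^ K := sub_nonneg.2 (pow_le_pow_left₀ ha₁.le h12 _)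
        refine mul_le_mul_of_nonneg_left ?_ h0
        rw [pow_succ']
        gcongr
        exact h12.trans h2L

/-- The constant `W = 2^{K+2} N^{K+1}/(K² t M^K) + 1` of Ford's Lemma 6.3.
[cite: Ford2002, Lemma 6.3] -/
def Wconst (K N : ℕ) (t M : ℝ) : ℝ := 2 ^ (K + 2) * (N : ℝ) ^ (K + 1) / ((K : ℝ) ^ 2 * t * M ^ K) + 1

/-- **At most `W` of the boxes `Ω_n` meet a given last coordinate (mod 1).** For every `x ∈ ℝ`,
`#{N < n ≤ R - 1 : x ∈ [γ_K(n+u) - δ_K, γ_K(n+u) + δ_K] + ℤ} ≤ W`.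
[cite: Ford2002, proof of Lemma 6.3 ("the number of such `n` is at most `W`")] -/
theorem sum_chi_le_W {t u M : ℝ} {N R k : ℕ} (hk : 1 ≤ k) (ht : 0 < t)
    (htN : t ≤ (N : ℝ) ^ (k + 1)) (hN : 1 ≤ N) (hR : R ≤ 2 * N) (hu0 : 0 < u) (hu1 : u ≤ 1)
    (hM : 1 ≤ M) (x : ℝ) :
    ∑ n ∈ Ioc N (R - 1), chi (gam t (n + u) (k + 1) (Fin.last k)) (del M (k + 1) (Fin.last k)) x
      ≤ Wconst (k + 1) N t M := by
  classical
  set δ := del M (k + 1) (Fin.last k) with hδ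
  set c : ℕ → ℝ := fun n => gam t (n + u) (k + 1) (Fin.last k) with hc
  have hM0 : 0 < M := by linarith
  have hδpos : 0 < δ := del_pos hM0 _
  have hK : (2 : ℝ) ≤ (k : ℝ) + 1 := by
    have : (1 : ℝ) ≤ k := by exact_mod_cast hk
    linarith
  -- sizes: `δ ≤ 1/(8π)` and `|c n| < 1/(4π)`
  have hδle : δ ≤ 1 / (8 * π) := by
    rw [hδ]; unfold del; simp only [Fin.val_last]
    rw [div_le_div_iff₀ (by positivity) (by positivity), one_mul, one_mul]
    have hMK : (1 : ℝ) ≤ M ^ (k + 1) := one_le_pow₀ hM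
    have hkk : (4 : ℝ) ≤ ((k : ℝ) + 1) * ((k + 1 : ℕ) : ℝ) := by push_cast; nlinarith
    calc 8 * π = 2 * π * 4 * 1 := by ring
      _ ≤ 2 * π * (((k : ℝ) + 1) * ((k + 1 : ℕ) : ℝ)) * M ^ (k + 1) := by gcongr
      _ = _ := by ring
  have hcn : ∀ n ∈ Ioc N (R - 1), |c n| < 1 / (4 * π) := by
    intro n hn
    rw [Finset.mem_Ioc] at hn
    have hna : (N : ℝ) < n + u := by
      have : (N : ℝ) + 1 ≤ n := by exact_mod_cast hn.1
      linarith
    have hta : t < ((n : ℝ) + u) ^ (k + 1) :=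
      lt_of_le_of_lt htN (pow_lt_pow_left₀ hna (by positivity) (by omega))
    refine (abs_gam_last_lt ht.le (by positivity) k hta).trans_le ?_
    rw [div_le_div_iff₀ (by positivity) (by positivity), one_mul, one_mul]
    nlinarith [Real.pi_pos]
  -- the qualifying `n`
  set Q := (Ioc N (R - 1)).filter (fun n => x ∈ nearSet (c n) δ) with hQ
  have hsum : ∑ n ∈ Ioc N (R - 1), chi (c n) δ x = (Q.card : ℝ) := by
    rw [hQ, Finset.card_filter, Nat.cast_sum]
    refine Finset.sum_congr rfl fun n _ => ?_
    rw [chi_apply]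
    split_ifs <;> simp
  have hW1 : (1 : ℝ) ≤ Wconst (k + 1) N t M := by
    unfold Wconst
    have : 0 ≤ 2 ^ (k + 1 + 2) * (N : ℝ) ^ (k + 1 + 1) / (((k + 1 : ℕ) : ℝ) ^ 2 * t * M ^ (k + 1)) :=
      by positivity
    linarith
  change ∑ n ∈ Ioc N (R - 1), chi (c n) δ x ≤ _
  rw [hsum]
  rcases Q.eq_empty_or_nonempty with hQe | hQne
  · rw [hQe, Finset.card_empty, Nat.cast_zero]; linarith
  -- all qualifying `n` share the same integer shift
  have hmemQ : ∀ n ∈ Q, n ∈ Ioc N (R - 1) ∧ ∃ v : ℤ, |x - c n - v| ≤ δ := fun n hn => by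
    rw [hQ, Finset.mem_filter] at hn
    exact ⟨hn.1, mem_nearSet_iff.1 hn.2⟩
  obtain ⟨n₀, hn₀⟩ := hQne
  obtain ⟨v₀, hv₀⟩ := (hmemQ n₀ hn₀).2
  have hshift : ∀ n ∈ Q, |x - c n - v₀| ≤ δ := by
    intro n hn
    obtain ⟨v, hv⟩ := (hmemQ n hn).2
    have hcn' := hcn n (hmemQ n hn).1
    have hcn₀ := hcn n₀ (hmemQ n₀ hn₀).1
    have hvv : |((v - v₀ : ℤ) : ℝ)| < 1 := by
      have e1 := abs_sub_abs_le_abs_sub (x - c n - v) (x - c n₀ - v₀)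
      have : ((v - v₀ : ℤ) : ℝ) = (c n₀ - c n) - ((x - c n - v) - (x - c n₀ - v₀)) := by
        push_cast; ring
      rw [this]
      refine (abs_sub _ _).trans_lt ?_
      have h3 : |(x - c n - v) - (x - c n₀ - v₀)| ≤ δ + δ :=
        (abs_sub _ _).trans (add_le_add hv hv₀)
      have h4 : |c n₀ - c n| ≤ |c n₀| + |c n| := abs_sub _ _
      have hπ : 1 / (4 * π) + 1 / (4 * π) + (1 / (8 * π) + 1 / (8 * π)) < 1 := by
        have := Real.pi_gt_three
        rw [show 1 / (4 * π) + 1 / (4 * π) + (1 / (8 * π) + 1 / (8 * π)) = 3 / (4 * π) by ring,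
          div_lt_one (by positivity)]
        linarith
      linarith
    have hv_eq : v = v₀ := by
      by_contra hne
      have : (1 : ℤ) ≤ |v - v₀| := Int.one_le_abs (sub_ne_zero.2 hne)
      have : (1 : ℝ) ≤ |((v - v₀ : ℤ) : ℝ)| := by exact_mod_cast this
      linarith
    rw [← hv_eq]; exact hv
  -- min and max of `Q`
  have hQne : Q.Nonempty := ⟨n₀, hn₀⟩
  set n₁ := Q.min' hQne with hn₁
  set n₂ := Q.max' hQne with hn₂
  have hn₁Q : n₁ ∈ Q := Finset.min'_mem Q hQne
  have hn₂Q : n₂ ∈ Q := Finset.max'_mem Q hQne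
  have h12 : n₁ ≤ n₂ := Finset.min'_le Q n₂ hn₂Q
  have hcard : Q.card ≤ n₂ + 1 - n₁ := by
    calc Q.card ≤ (Finset.Icc n₁ n₂).card :=
          Finset.card_le_card fun n hn => Finset.mem_Icc.2 ⟨Finset.min'_le Q n hn, Finset.le_max' Q n hn⟩
      _ = n₂ + 1 - n₁ := Nat.card_Icc n₁ n₂
  have hcardR : (Q.card : ℝ) ≤ (n₂ : ℝ) - n₁ + 1 := by
    have : (Q.card : ℝ) ≤ ((n₂ + 1 - n₁ : ℕ) : ℝ) := by exact_mod_cast hcard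
    rw [Nat.cast_sub (by omega)] at this
    push_cast at this
    linarith
  -- the two extreme coefficients are within `2δ`, but at least `(n₂ - n₁) t/(2π (2N)^{K+1})` apart
  have hr₁ := (hmemQ n₁ hn₁Q).1
  have hr₂ := (hmemQ n₂ hn₂Q).1
  rw [Finset.mem_Ioc] at hr₁ hr₂
  have ha₁ : (0 : ℝ) < n₁ + u := by positivity
  have ha12 : (n₁ : ℝ) + u ≤ n₂ + u := by
    have : (n₁ : ℝ) ≤ n₂ := by exact_mod_cast h12
    linarith
  have ha₂L : (n₂ : ℝ) + u ≤ 2 * N := by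
    have : (n₂ : ℝ) + 1 ≤ 2 * N := by
      have h' : n₂ + 1 ≤ 2 * N := by omega
      exact_mod_cast h'
    linarith
  have hupper : |c n₁ - c n₂| ≤ 2 * δ := by
    have e : c n₁ - c n₂ = (x - c n₂ - v₀) - (x - c n₁ - v₀) := by ring
    rw [e]
    exact (abs_sub _ _).trans (by linarith [hshift n₁ hn₁Q, hshift n₂ hn₂Q])
  have hlower : t / (2 * π) * ((n₂ : ℝ) - n₁) / (2 * N) ^ (k + 2) ≤ |c n₁ - c n₂| := by
    rw [hc]
    simp only
    rw [abs_gam_last_sub ht.le ha₁ ha12 k]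
    have := inv_pow_sub_inv_pow_ge ha₁ ha12 ha₂L (k + 1)
    rw [show (n₂ : ℝ) + u - (n₁ + u) = n₂ - n₁ by ring] at this
    calc t / (2 * π) * ((n₂ : ℝ) - n₁) / (2 * N) ^ (k + 2)
        = t / (2 * π * (k + 1)) * (((k + 1 : ℕ) : ℝ) * ((n₂ : ℝ) - n₁) / (2 * N) ^ (k + 1 + 1)) := by
          push_cast; field_simp
      _ ≤ _ := mul_le_mul_of_nonneg_left this (by positivity)
  -- conclude
  have hgap : (n₂ : ℝ) - n₁ ≤ 2 ^ (k + 1 + 2) * (N : ℝ) ^ (k + 1 + 1)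
      / (((k + 1 : ℕ) : ℝ) ^ 2 * t * M ^ (k + 1)) := by
    have h := hlower.trans hupper
    rw [hδ] at h; unfold del at h; simp only [Fin.val_last] at h
    rw [div_le_iff₀ (by positivity)] at h
    rw [le_div_iff₀ (by positivity)]
    have e1 : (2 : ℝ) ^ (k + 1 + 2) * (N : ℝ) ^ (k + 1 + 1) = 2 * (2 * N) ^ (k + 2) := by ring
    rw [e1]
    have h' : t * ((n₂ : ℝ) - n₁) * (((k : ℝ) + 1) * ↑(k + 1) * M ^ (k + 1))
        ≤ 2 * (2 * N) ^ (k + 2) := by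
      have h2 := mul_le_mul_of_nonneg_right h
        (by positivity : (0 : ℝ) ≤ 2 * π * (((k : ℝ) + 1) * ↑(k + 1) * M ^ (k + 1)))
      have e2 : t / (2 * π) * ((n₂ : ℝ) - n₁) * (2 * π * (((k : ℝ) + 1) * ↑(k + 1) * M ^ (k + 1)))
          = t * ((n₂ : ℝ) - n₁) * (((k : ℝ) + 1) * ↑(k + 1) * M ^ (k + 1)) * (2 * N) ^ (k + 2)
            / (2 * N) ^ (k + 2) := by field_simp
      have e3 : 2 * (1 / (2 * π * ((k : ℝ) + 1) * ↑(k + 1) * M ^ (k + 1))) * (2 * N) ^ (k + 2)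
          * (2 * π * (((k : ℝ) + 1) * ↑(k + 1) * M ^ (k + 1))) = 2 * (2 * N) ^ (k + 2) := by
        field_simp
      rw [e2, e3, mul_div_assoc] at h2
      rwa [div_self (by positivity), mul_one] at h2
    calc ((n₂ : ℝ) - n₁) * (((k + 1 : ℕ) : ℝ) ^ 2 * t * M ^ (k + 1))
        = t * ((n₂ : ℝ) - n₁) * (((k : ℝ) + 1) * ↑(k + 1) * M ^ (k + 1)) := by push_cast; ring
      _ ≤ _ := h'
  unfold Wconst
  linarith


/-! ### From the boxes `Ω_n` to one unit box: periodicity and the count -/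

/-- `δ_j < 1/2` (`M ≥ 1`, `k ≥ 1`). [folklore] -/
theorem del_lt_half {M : ℝ} (hM : 1 ≤ M) {k : ℕ} (j : Fin k) : del M k j < 1 / 2 := by
  unfold del
  have hk : (1 : ℝ) ≤ k := by
    have := j.isLt
    exact_mod_cast Nat.one_le_of_lt this
  have hMj : (1 : ℝ) ≤ M ^ (j.val + 1) := one_le_pow₀ hM
  rw [div_lt_div_iff₀ (by positivity) (by positivity), one_mul, one_mul]
  have hj : (1 : ℝ) ≤ (j.val : ℝ) + 1 := by
    have : (0 : ℝ) ≤ j.val := Nat.cast_nonneg _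
    linarith
  calc (2 : ℝ) < 2 * π * 1 * 1 * 1 := by nlinarith [Real.pi_gt_three]
    _ ≤ 2 * π * ((j.val : ℝ) + 1) * k * M ^ (j.val + 1) := by gcongr

/-- A unit box lies in the closed box with the same corners. [folklore] -/
theorem unitBox_subset_Icc {k : ℕ} (a : Fin k → ℝ) : unitBox a ⊆ Set.Icc a (fun j => a j + 1) := by
  intro x hx
  simp only [unitBox, Set.mem_pi, Set.mem_univ, Set.mem_Ioc, forall_const] at hx
  exact ⟨fun j => (hx j).1.le, fun j => (hx j).2⟩

/-- `unitBox a` has finite volume. [folklore] -/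
theorem volume_unitBox_lt_top {k : ℕ} (a : Fin k → ℝ) : volume (unitBox a) < ⊤ :=
  lt_of_le_of_lt (measure_mono (unitBox_subset_Icc a)) measure_Icc_lt_top

/-- Continuous functions are integrable on unit boxes. [folklore] -/
theorem integrableOn_unitBox_of_continuous {k : ℕ} {f : (Fin k → ℝ) → ℝ} (hf : Continuous f)
    (a : Fin k → ℝ) : IntegrableOn f (unitBox a) :=
  (hf.continuousOn.integrableOn_compact isCompact_Icc).mono_set (unitBox_subset_Icc a)

/-- The periodized integrand `χ_n(β_K) S₀(β)^{2s}`. [folklore] -/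
def perI (k s : ℕ) (M c δ : ℝ) (β : Fin (k + 1) → ℝ) : ℝ :=
  chi c δ (β (Fin.last k)) * S0 (k + 1) M β ^ (2 * s)

/-- `perI` is measurable. [folklore] -/
theorem measurable_perI (k s : ℕ) (M c δ : ℝ) : Measurable (perI k s M c δ) := by
  unfold perI
  exact ((measurable_chi c δ).comp (measurable_pi_apply _)).mul
    ((continuous_S0 (k + 1) M).pow _).measurable

/-- `perI ≥ 0`. [folklore] -/
theorem perI_nonneg (k s : ℕ) {M : ℝ} (hM : 0 ≤ M) (c δ : ℝ) (β : Fin (k + 1) → ℝ) :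
    0 ≤ perI k s M c δ β := by
  unfold perI
  exact mul_nonneg (chi_nonneg _ _ _) (pow_nonneg (S0_nonneg _ hM _) _)

/-- `perI ≤ S₀^{2s}`. [folklore] -/
theorem perI_le (k s : ℕ) {M : ℝ} (hM : 0 ≤ M) (c δ : ℝ) (β : Fin (k + 1) → ℝ) :
    perI k s M c δ β ≤ S0 (k + 1) M β ^ (2 * s) := by
  unfold perI
  have h0 : 0 ≤ S0 (k + 1) M β ^ (2 * s) := pow_nonneg (S0_nonneg _ hM _) _
  calc _ ≤ 1 * S0 (k + 1) M β ^ (2 * s) := mul_le_mul_of_nonneg_right (chi_le_one _ _ _) h0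
    _ = _ := one_mul _

/-- `perI` is `ℤ^{k+1}`-periodic. [folklore] -/
theorem perI_add_int (k s : ℕ) (M c δ : ℝ) (β : Fin (k + 1) → ℝ) (v : Fin (k + 1) → ℤ) :
    perI k s M c δ (fun j => β j + v j) = perI k s M c δ β := by
  unfold perI
  rw [S0_add_int, chi_add_int]

/-- `perI` is integrable on unit boxes. [folklore] -/
theorem integrableOn_perI (k s : ℕ) (M c δ : ℝ) (a : Fin (k + 1) → ℝ) :
    IntegrableOn (perI k s M c δ) (unitBox a) := by
  unfold perI
  refine Integrable.bdd_mul (c := 1)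
    (integrableOn_unitBox_of_continuous ((continuous_S0 (k + 1) M).pow _) a) ?_ ?_
  · exact ((measurable_chi c δ).comp (measurable_pi_apply _)).aestronglyMeasurable
  · refine ae_of_all _ fun β => ?_
    rw [Real.norm_eq_abs, abs_of_nonneg (chi_nonneg _ _ _)]
    exact chi_le_one _ _ _

/-- **From `Ω_n` to a unit box**: `∫_{Ω_n} S₀^{2s} ≤ ∫_{(0,1]^{K}} χ_n(β_K) S₀(β)^{2s} dβ`.
[cite: Ford2002, proof of Lemma 6.3 ("integrating over `Ω_n`")] -/
theorem integral_Omega_le_integral_unitBox (k s : ℕ) {t a M : ℝ} (hM : 1 ≤ M) :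
    ∫ β in Omega t a M (k + 1), S0 (k + 1) M β ^ (2 * s)
      ≤ ∫ β in unitBox (0 : Fin (k + 1) → ℝ),
          perI k s M (gam t a (k + 1) (Fin.last k)) (del M (k + 1) (Fin.last k)) β := by
  set c := gam t a (k + 1) (Fin.last k) with hc
  set δ := del M (k + 1) (Fin.last k) with hδ
  set B := unitBox (fun j => gam t a (k + 1) j - 1 / 2) with hB
  have hM0 : 0 ≤ M := by linarith
  -- on `Ω_n` the integrand is `perI`
  have h1 : ∫ β in Omega t a M (k + 1), S0 (k + 1) M β ^ (2 * s)
      = ∫ β in Omega t a M (k + 1), perI k s M c δ β := by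
    refine setIntegral_congr_fun measurableSet_Icc fun β hβ => ?_
    have hj := (mem_Omega.1 hβ) (Fin.last k)
    unfold perI
    rw [chi_eq_one_of_abs_le hj, one_mul]
  -- `Ω_n ⊆ B`
  have hsub : Omega t a M (k + 1) ⊆ B := by
    intro β hβ
    have hβ' := mem_Omega.1 hβ
    rw [hB]
    simp only [unitBox, Set.mem_pi, Set.mem_univ, Set.mem_Ioc, forall_const]
    intro j
    have h2 := hβ' j
    have h3 := del_lt_half hM (k := k + 1) j
    rw [abs_sub_le_iff] at h2
    constructor <;> linarith [h2.1, h2.2]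
  have h2 : ∫ β in Omega t a M (k + 1), perI k s M c δ β ≤ ∫ β in B, perI k s M c δ β :=
    setIntegral_mono_set (integrableOn_perI k s M c δ _)
      (ae_of_all _ fun β => perI_nonneg k s hM0 c δ β) (ae_of_all _ hsub)
  have h3 : ∫ β in B, perI k s M c δ β = ∫ β in unitBox (0 : Fin (k + 1) → ℝ), perI k s M c δ β :=
    setIntegral_unitBox_eq_of_periodic (measurable_perI k s M c δ)
      (fun β v => perI_add_int k s M c δ β v) _ _
  rw [h1, ← h3]
  exact h2

/-- **Summing over `n`**: with `W` from `sum_chi_le_W`,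
`∑_{N<n≤R-1} ∫_{(0,1]^K} χ_n S₀^{2s} ≤ W ∫_{(0,1]^K} S₀^{2s}`. [cite: Ford2002, (6.9)] -/
theorem sum_integral_perI_le {t u M : ℝ} {N R k : ℕ} (s : ℕ) (hk : 1 ≤ k) (ht : 0 < t)
    (htN : t ≤ (N : ℝ) ^ (k + 1)) (hN : 1 ≤ N) (hR : R ≤ 2 * N) (hu0 : 0 < u) (hu1 : u ≤ 1)
    (hM : 1 ≤ M) :
    ∑ n ∈ Ioc N (R - 1), ∫ β in unitBox (0 : Fin (k + 1) → ℝ),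
        perI k s M (gam t (n + u) (k + 1) (Fin.last k)) (del M (k + 1) (Fin.last k)) β
      ≤ Wconst (k + 1) N t M * ∫ β in unitBox (0 : Fin (k + 1) → ℝ), S0 (k + 1) M β ^ (2 * s) := by
  set U := unitBox (0 : Fin (k + 1) → ℝ) with hU
  set δ := del M (k + 1) (Fin.last k) with hδ
  have hM0 : 0 ≤ M := by linarith
  rw [← integral_finsetSum _ fun n _ => integrableOn_perI k s M _ δ _, ← integral_const_mul]
  refine setIntegral_mono_on (integrable_finsetSum _ fun n _ => integrableOn_perI k s M _ δ _)
    ((integrableOn_unitBox_of_continuous ((continuous_S0 (k + 1) M).pow _) _).const_mul _)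
    (measurableSet_unitBox _) fun β _ => ?_
  have hG : 0 ≤ S0 (k + 1) M β ^ (2 * s) := pow_nonneg (S0_nonneg _ hM0 _) _
  unfold perI
  rw [← Finset.sum_mul]
  exact mul_le_mul_of_nonneg_right (sum_chi_le_W hk ht htN hN hR hu0 hu1 hM _) hG

/-! ### The moment bound `∫_{(0,1]^K} S₀^{2s} ≤ 2^{4s} J_{s,K}(⌊M⌋)` -/

/-- `∫_{[0,1]^K} |∑_{x ∈ I} e(α·ν(x))|^{2s} dα = J_{s,K}(I)`: the mean value is the number of
solutions (from `VinogradovTorus`). [cite: Ford2002, (1.3)–(1.4)] -/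
theorem integral_norm_tp_nu_pow (K s : ℕ) (I : Finset ℤ) :
    ∫ α in box K, ‖tp I (nu K) α‖ ^ (2 * s) = (J K s I : ℝ) := by
  rw [show (fun α => ‖tp I (nu K) α‖ ^ (2 * s)) = fun α => ‖(tp I (nu K) α) ^ s‖ ^ 2 by
    funext α; rw [norm_pow, ← pow_mul, mul_comm]]
  simp_rw [← tp_tuples_psv]
  rw [integral_norm_sq_tp]
  unfold J Jc
  congr 2
  refine Finset.filter_congr fun yy _ => ?_
  rw [add_zero]

/-- The unit box `(0,1]^K` and the closed box `[0,1]^K` of `VinogradovTorus` agree a.e.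
[folklore] -/
theorem unitBox_zero_ae_eq_box (K : ℕ) : unitBox (0 : Fin K → ℝ) =ᵐ[volume] box K := by
  have h := Measure.pi_Ioc_ae_eq_pi_Icc (μ := fun _ : Fin K => (volume : Measure ℝ))
    (s := Set.univ) (f := fun _ => (0 : ℝ)) (g := fun _ => (1 : ℝ))
  rw [← volume_pi] at h
  have e1 : unitBox (0 : Fin K → ℝ) = Set.univ.pi fun _ : Fin K => Set.Ioc (0 : ℝ) 1 := by
    unfold unitBox; simp
  rw [e1]
  exact h

/-- `∫_{(0,1]^K} |A_m(β)|^{2s} dβ = J_{s,K}([1, m])`. [folklore] -/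
theorem integral_norm_Spart_pow (K s m : ℕ) :
    ∫ β in unitBox (0 : Fin K → ℝ), ‖Spart K β m‖ ^ (2 * s)
      = (J K s (Finset.Icc (1 : ℤ) m) : ℝ) := by
  rw [setIntegral_congr_set (unitBox_zero_ae_eq_box K)]
  simp_rw [Spart_eq_tp]
  exact integral_norm_tp_nu_pow K s _

/-- Monotonicity `J_{s,K}([1, m]) ≤ J_{s,K}([1, m'])` for `m ≤ m'`. [cite: Ford2002, §6 ("`J_{s,k}(w)` is
non-decreasing")] -/
theorem J_Icc_mono (K s : ℕ) {m m' : ℕ} (h : m ≤ m') :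
    J K s (Finset.Icc (1 : ℤ) m) ≤ J K s (Finset.Icc (1 : ℤ) m') :=
  Jc_mono K s (Finset.Icc_subset_Icc_right (by exact_mod_cast h)) 0

/-- **The moment bound** `∫_{(0,1]^K} S₀(β)^{2s} dβ ≤ 2^{4s} J_{s,K}([1, ⌊M⌋])` (`s ≥ 1`).
[cite: Ford2002, proof of Lemma 6.3 (last display)] -/
theorem integral_S0_pow_le (K : ℕ) {s : ℕ} (hs : 1 ≤ s) {M : ℝ} (hM : 1 ≤ M) :
    ∫ β in unitBox (0 : Fin K → ℝ), S0 K M β ^ (2 * s)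
      ≤ 2 ^ (4 * s) * (J K s (Finset.Icc (1 : ℤ) ⌊M⌋₊) : ℝ) := by
  set M' := ⌊M⌋₊ with hM'
  set U := unitBox (0 : Fin K → ℝ) with hU
  have hM0 : 0 < M := by linarith
  have hM'M : (M' : ℝ) ≤ M := Nat.floor_le hM0.le
  obtain ⟨r, hr⟩ : ∃ r, 2 * s = r + 1 := ⟨2 * s - 1, by omega⟩
  set L := (Ico 1 M').card with hL
  -- pointwise bound
  have hpt : ∀ β : Fin K → ℝ, S0 K M β ^ (2 * s)
      ≤ 2 ^ (2 * s - 1) * (‖Spart K β M'‖ ^ (2 * s)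
        + (2 / M) ^ (2 * s) * ((L : ℝ) ^ r * ∑ m ∈ Ico 1 M', ‖Spart K β m‖ ^ (2 * s))) := by
    intro β
    unfold S0
    have hx : 0 ≤ ‖Spart K β M'‖ := norm_nonneg _
    have hsum0 : 0 ≤ ∑ m ∈ Ico 1 M', ‖Spart K β m‖ := Finset.sum_nonneg fun _ _ => norm_nonneg _
    have hy : 0 ≤ 2 / M * ∑ m ∈ Ico 1 M', ‖Spart K β m‖ := by positivity
    refine (add_pow_le hx hy (2 * s)).trans ?_
    refine mul_le_mul_of_nonneg_left (add_le_add le_rfl ?_) (by positivity)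
    rw [mul_pow]
    refine mul_le_mul_of_nonneg_left ?_ (by positivity)
    rw [hr]
    exact pow_sum_le_card_mul_sum_pow (fun m _ => norm_nonneg (Spart K β m)) r
  -- integrate
  have hint : ∀ m, IntegrableOn (fun β : Fin K → ℝ => ‖Spart K β m‖ ^ (2 * s)) U := fun m =>
    integrableOn_unitBox_of_continuous ((continuous_Spart K m).norm.pow _) _
  have hI1 : IntegrableOn (fun β : Fin K → ℝ => S0 K M β ^ (2 * s)) U :=
    integrableOn_unitBox_of_continuous ((continuous_S0 K M).pow _) _
  have hIsum : IntegrableOn (fun β : Fin K → ℝ => ∑ m ∈ Ico 1 M', ‖Spart K β m‖ ^ (2 * s)) U :=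
    integrable_finsetSum _ fun m _ => hint m
  have hI3 : IntegrableOn (fun β : Fin K → ℝ =>
      (2 / M) ^ (2 * s) * ((L : ℝ) ^ r * ∑ m ∈ Ico 1 M', ‖Spart K β m‖ ^ (2 * s))) U :=
    (hIsum.const_mul _).const_mul _
  have hI2 : IntegrableOn (fun β : Fin K → ℝ => 2 ^ (2 * s - 1) * (‖Spart K β M'‖ ^ (2 * s)
      + (2 / M) ^ (2 * s) * ((L : ℝ) ^ r * ∑ m ∈ Ico 1 M', ‖Spart K β m‖ ^ (2 * s)))) U :=
    ((hint M').add hI3).const_mul _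
  set Jt : ℝ := (J K s (Finset.Icc (1 : ℤ) M') : ℝ) with hJt
  have hJ0 : 0 ≤ Jt := Nat.cast_nonneg _
  have hsumJ : ∑ m ∈ Ico 1 M', (J K s (Finset.Icc (1 : ℤ) m) : ℝ) ≤ L * Jt := by
    calc ∑ m ∈ Ico 1 M', (J K s (Finset.Icc (1 : ℤ) m) : ℝ) ≤ ∑ _m ∈ Ico 1 M', Jt := by
          refine Finset.sum_le_sum fun m hm => ?_
          rw [Finset.mem_Ico] at hm
          rw [hJt]
          exact_mod_cast J_Icc_mono K s hm.2.le
      _ = L * Jt := by rw [Finset.sum_const, nsmul_eq_mul, hL]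
  have hLM : (L : ℝ) ≤ M := by
    rw [hL, Nat.card_Ico]
    have : ((M' - 1 : ℕ) : ℝ) ≤ M' := by exact_mod_cast Nat.sub_le M' 1
    linarith
  have hL0 : (0 : ℝ) ≤ L := Nat.cast_nonneg _
  calc ∫ β in U, S0 K M β ^ (2 * s)
      ≤ ∫ β in U, 2 ^ (2 * s - 1) * (‖Spart K β M'‖ ^ (2 * s)
          + (2 / M) ^ (2 * s) * ((L : ℝ) ^ r * ∑ m ∈ Ico 1 M', ‖Spart K β m‖ ^ (2 * s))) :=
        setIntegral_mono_on hI1 hI2 (measurableSet_unitBox _) fun β _ => hpt β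
    _ = 2 ^ (2 * s - 1) * (Jt + (2 / M) ^ (2 * s) * ((L : ℝ) ^ r
            * ∑ m ∈ Ico 1 M', (J K s (Finset.Icc (1 : ℤ) m) : ℝ))) := by
        rw [integral_const_mul, integral_add (hint M') hI3, integral_const_mul,
          integral_const_mul, integral_finsetSum _ fun m _ => hint m]
        rw [hU, integral_norm_Spart_pow]
        congr 3
        exact congrArg _ (Finset.sum_congr rfl fun m _ => integral_norm_Spart_pow K s m)
    _ ≤ 2 ^ (2 * s - 1) * (Jt + (2 / M) ^ (2 * s) * ((L : ℝ) ^ r * (L * Jt))) := by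
        gcongr
    _ = 2 ^ (2 * s - 1) * Jt * (1 + 2 ^ (2 * s) * ((L : ℝ) / M) ^ (2 * s)) := by
        rw [hr, div_pow, div_pow]
        field_simp
        ring
    _ ≤ 2 ^ (2 * s - 1) * Jt * (1 + 2 ^ (2 * s) * 1) := by
        gcongr
        exact pow_le_one₀ (by positivity) ((div_le_one hM0).2 hLM)
    _ ≤ 2 ^ (4 * s) * Jt := by
        rw [mul_comm (2 ^ (2 * s - 1) * Jt), ← mul_assoc]
        refine mul_le_mul_of_nonneg_right ?_ hJ0
        have h2 : (2 : ℝ) ^ (4 * s) = 2 ^ (2 * s - 1) * 2 ^ (2 * s + 1) := by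
          rw [← pow_add]; congr 1; omega
        rw [h2, mul_comm]
        refine mul_le_mul_of_nonneg_left ?_ (by positivity)
        rw [pow_succ, mul_one]
        have : (1 : ℝ) ≤ 2 ^ (2 * s) := one_le_pow₀ (by norm_num)
        linarith


/-! ### Assembly: Ford's Lemma 6.3 -/

/-- `∑_j (j + 1) = K(K+1)/2` over `Fin K`. [folklore] -/
theorem sum_fin_succ_eq (K : ℕ) : ∑ j : Fin K, (j.val + 1) = K * (K + 1) / 2 := by
  rw [Fin.sum_univ_eq_sum_range (fun j => j + 1) K]
  have h1 : ∑ j ∈ range K, (j + 1) = ∑ i ∈ range (K + 1), i := by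
    rw [Finset.sum_range_succ', add_zero]
  have h2 := Finset.sum_range_id_mul_two (K + 1)
  rw [Nat.add_sub_cancel] at h2
  rw [h1]
  symm
  apply Nat.div_eq_of_eq_mul_left two_pos
  rw [mul_comm K]; exact h2.symm

/-- The volume factor: `∏_j 2δ_j = (π^K K^K K! M^{K(K+1)/2})^{-1}`.
[cite: Ford2002, proof of Lemma 6.3 ("`|Ω_n|^{-1} = π^k k! k^k M^{k(k+1)/2}`")] -/
theorem prod_two_del {M : ℝ} (hM : 0 < M) (K : ℕ) :
    ∏ j : Fin K, (2 * del M K j)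
      = (π ^ K * (K : ℝ) ^ K * (Nat.factorial K : ℝ) * M ^ (K * (K + 1) / 2))⁻¹ := by
  have hfac : ∀ j : Fin K, 2 * del M K j = (π * ((j.val + 1 : ℕ) : ℝ) * K * M ^ (j.val + 1))⁻¹ := by
    intro j
    unfold del
    push_cast
    field_simp
  rw [Finset.prod_congr rfl fun j _ => hfac j, Finset.prod_inv_distrib]
  congr 1
  rw [Finset.prod_mul_distrib, Finset.prod_mul_distrib, Finset.prod_mul_distrib, Finset.prod_const,
    Finset.prod_const, Finset.card_univ, Fintype.card_fin, Finset.prod_pow_eq_pow_sum,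
    sum_fin_succ_eq]
  have hprodfac : ∏ j : Fin K, ((j.val + 1 : ℕ) : ℝ) = (Nat.factorial K : ℝ) := by
    rw [Fin.prod_univ_eq_prod_range (fun j => ((j + 1 : ℕ) : ℝ)) K]
    exact_mod_cast Finset.prod_range_add_one_eq_factorial K
  rw [hprodfac]
  ring

/-- Power-mean (Hölder) step: `∑ a_i ≤ (#S)^{1-1/(2s)} (∑ a_i^{2s})^{1/(2s)}` for `a_i ≥ 0`,
`s ≥ 1`. [folklore] -/
theorem sum_le_card_rpow_mul {ι : Type*} (S : Finset ι) {a : ι → ℝ} (ha : ∀ i ∈ S, 0 ≤ a i)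
    {s : ℕ} (hs : 1 ≤ s) :
    ∑ i ∈ S, a i ≤ (S.card : ℝ) ^ (1 - 1 / (2 * s : ℝ)) * (∑ i ∈ S, a i ^ (2 * s)) ^ (1 / (2 * s : ℝ)) := by
  obtain ⟨r, hr⟩ : ∃ r, 2 * s = r + 1 := ⟨2 * s - 1, by omega⟩
  have hsum0 : 0 ≤ ∑ i ∈ S, a i := Finset.sum_nonneg ha
  have hpow : (∑ i ∈ S, a i) ^ (2 * s) ≤ (S.card : ℝ) ^ r * ∑ i ∈ S, a i ^ (2 * s) := by
    rw [hr]; exact pow_sum_le_card_mul_sum_pow ha r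
  have h2s : ((2 * s : ℕ) : ℝ) = 2 * (s : ℝ) := by push_cast; ring
  have h2s0 : (2 * (s : ℝ)) ≠ 0 := by positivity
  have hinv : (1 / (2 * s : ℝ)) = ((2 * s : ℕ) : ℝ)⁻¹ := by rw [h2s, one_div]
  have hlhs : ∑ i ∈ S, a i = ((∑ i ∈ S, a i) ^ (2 * s)) ^ (1 / (2 * s : ℝ)) := by
    rw [hinv, Real.pow_rpow_inv_natCast hsum0 (by omega)]
  rw [hlhs]
  refine (Real.rpow_le_rpow (by positivity) hpow (by positivity)).trans (le_of_eq ?_)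
  rw [Real.mul_rpow (pow_nonneg (Nat.cast_nonneg _) _)
    (Finset.sum_nonneg fun i hi => pow_nonneg (ha i hi) _)]
  congr 1
  rw [← Real.rpow_natCast, ← Real.rpow_mul (Nat.cast_nonneg _)]
  congr 1
  have : (r : ℝ) = 2 * s - 1 := by
    have : ((2 * s : ℕ) : ℝ) = r + 1 := by exact_mod_cast hr
    push_cast at this; linarith
  rw [this]
  field_simp

/-- The shifted terms factor: `(n + m + u)^{-it} = e(-(t/2π) log(n+u)) e(-(t/2π) log(1 + m/(n+u)))`.
[folklore] -/
theorem cpow_shift_eq (t : ℝ) {u : ℝ} (hu : 0 < u) (n m : ℕ) :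
    (((n + m : ℕ) : ℂ) + u) ^ (-(t * Complex.I))
      = e (-(t / (2 * π)) * Real.log (n + u)) * e (-(t / (2 * π)) * Real.log (1 + m / (n + u))) := by
  have hnu : 0 < (n : ℝ) + u := by positivity
  have h1 : 0 < 1 + (m : ℝ) / (n + u) := by positivity
  rw [← e_add, ← mul_add, ← Real.log_mul hnu.ne' h1.ne',
    show ((n : ℝ) + u) * (1 + m / (n + u)) = ((n + m : ℕ) : ℝ) + u by push_cast; field_simp; ring,
    ← phaseD_zero, e_phaseD_zero_of_pos t (by positivity : 0 < ((n + m : ℕ) : ℝ) + u)]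
  push_cast
  ring_nf

/-- **Ford's Lemma 6.3** (after Titchmarsh, §6.12). Let `k ≥ 2`, `s ≥ 1`, `1 ≤ N < R ≤ 2N`,
`0 < u ≤ 1`, `N ≤ t ≤ N^k`, and `1 ≤ M` with `t M^{k+1} ≤ N^{k+1}` (i.e. `M ≤ N t^{-1/(k+1)}`). Then
`‖∑_{N<n≤R} (n+u)^{-it}‖ ≤ (4N^{1-1/(2s)}/M) (π^k k! k^k W M^{k(k+1)/2} J_{s,k}(⌊M⌋))^{1/(2s)} + N/M + M`
with `W = 2^{k+2} N^{k+1}/(k² t M^k) + 1` and `J_{s,k}(P)` the number of solutions of Vinogradov's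
system (`VMV.J k s [1, P]`). [cite: Ford2002, Lemma 6.3] -/
theorem ford_lemma63 {k s N R : ℕ} {t u M : ℝ} (hk : 2 ≤ k) (hs : 1 ≤ s) (hN : 1 ≤ N)
    (hNR : N < R) (hR : R ≤ 2 * N) (hu0 : 0 < u) (hu1 : u ≤ 1) (hNt : (N : ℝ) ≤ t)
    (htN : t ≤ (N : ℝ) ^ k) (hM : 1 ≤ M) (hMt : t * M ^ (k + 1) ≤ (N : ℝ) ^ (k + 1)) :
    ‖∑ n ∈ Ioc N R, ((n : ℂ) + u) ^ (-(t * Complex.I))‖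
      ≤ 4 * (N : ℝ) ^ (1 - 1 / (2 * s : ℝ)) / M
          * (π ^ k * (Nat.factorial k : ℝ) * (k : ℝ) ^ k * Wconst k N t M * M ^ (k * (k + 1) / 2)
              * (J k s (Finset.Icc (1 : ℤ) ⌊M⌋₊) : ℝ)) ^ (1 / (2 * s : ℝ))
        + N / M + M := by
  obtain ⟨k, rfl⟩ : ∃ k', k = k' + 1 := ⟨k - 1, by omega⟩
  have hk1 : 1 ≤ k := by omega
  have hN0 : 0 < N := hN
  have hNpos : (0 : ℝ) < N := by exact_mod_cast hN0
  have ht : 0 < t := lt_of_lt_of_le hNpos hNt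
  have hM0 : 0 < M := by linarith
  -- `M ≤ N`
  have hMN : M ≤ N := by
    have h1 : M ^ ((k + 1) + 1) ≤ (N : ℝ) ^ ((k + 1) + 1) := by
      have : M ^ ((k + 1) + 1) ≤ t * M ^ ((k + 1) + 1) := by
        have h1t : (1 : ℝ) ≤ t := le_trans (by exact_mod_cast hN) hNt
        nlinarith [pow_pos hM0 ((k + 1) + 1)]
      exact this.trans hMt
    exact (pow_le_pow_iff_left₀ hM0.le hNpos.le (by omega)).1 h1
  -- Weyl shift
  set F : ℕ → ℂ := fun n => ((n : ℂ) + u) ^ (-(t * Complex.I)) with hF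
  have hF1 : ∀ i, ‖F i‖ ≤ 1 := by
    intro i
    show ‖((i : ℂ) + u) ^ (-(t * Complex.I))‖ ≤ 1
    have := norm_ofReal_cpow_neg_mul_I (x := (i : ℝ) + u) (by positivity) t
    push_cast at this
    exact this.le
  have hW := weylShift hF1 hNR hR hM hMN
  -- the inner sums are the `T(n)`
  have hTn : ∀ n : ℕ, ‖∑ m ∈ Icc 1 ⌊M⌋₊, F (n + m)‖ = ‖Tsum t (n + u) M‖ := by
    intro n
    have : ∑ m ∈ Icc 1 ⌊M⌋₊, F (n + m)
        = e (-(t / (2 * π)) * Real.log (n + u)) * Tsum t (n + u) M := by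
      unfold Tsum
      rw [Finset.mul_sum]
      refine Finset.sum_congr rfl fun m _ => ?_
      rw [hF]
      exact cpow_shift_eq t hu0 n m
    rw [this, norm_mul, norm_e, one_mul]
  simp_rw [hTn] at hW
  -- the `2s`-th moments of the `T(n)`
  set 𝒩 := Ioc N (R - 1) with h𝒩
  set V : ℝ := π ^ (k + 1) * ((k + 1 : ℕ) : ℝ) ^ (k + 1) * (Nat.factorial (k + 1) : ℝ) * M ^ ((k + 1) * ((k + 1) + 1) / 2) with hV
  have hV0 : 0 < V := by positivity
  have hprod : ∏ j : Fin (k + 1), (2 * del M (k + 1) j) = V⁻¹ := prod_two_del hM0 (k + 1)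
  have hTpow : ∀ n ∈ 𝒩, ‖Tsum t (n + u) M‖ ^ (2 * s)
      ≤ V * ∫ β in unitBox (0 : Fin (k + 1) → ℝ), perI k s M (gam t (n + u) (k + 1) (Fin.last k)) (del M (k + 1) (Fin.last k)) β := by
    intro n hn
    rw [h𝒩, Finset.mem_Ioc] at hn
    have haN : (N : ℝ) ≤ n + u := by
      have : (N : ℝ) + 1 ≤ n := by exact_mod_cast hn.1
      linarith
    have h1 := norm_Tsum_pow_mul_le_integral (by omega : 1 ≤ (k + 1)) ht.le hN0 haN hM hMt s
    have h2 := integral_Omega_le_integral_unitBox k s (t := t) (a := (n : ℝ) + u) hM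
    rw [hprod] at h1
    have h3 := h1.trans h2
    rw [← div_eq_mul_inv, div_le_iff₀ hV0] at h3
    exact h3.trans (le_of_eq (mul_comm _ _))
  have hsumT : ∑ n ∈ 𝒩, ‖Tsum t (n + u) M‖ ^ (2 * s)
      ≤ V * (Wconst (k + 1) N t M * (2 ^ (4 * s) * (J (k + 1) s (Finset.Icc (1 : ℤ) ⌊M⌋₊) : ℝ))) := by
    calc ∑ n ∈ 𝒩, ‖Tsum t (n + u) M‖ ^ (2 * s)
        ≤ ∑ n ∈ 𝒩, V * ∫ β in unitBox (0 : Fin (k + 1) → ℝ), perI k s M (gam t (n + u) (k + 1) (Fin.last k)) (del M (k + 1) (Fin.last k)) β :=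
          Finset.sum_le_sum hTpow
      _ = V * ∑ n ∈ 𝒩, ∫ β in unitBox (0 : Fin (k + 1) → ℝ), perI k s M (gam t (n + u) (k + 1) (Fin.last k)) (del M (k + 1) (Fin.last k)) β := by
          rw [Finset.mul_sum]
      _ ≤ V * (Wconst (k + 1) N t M * ∫ β in unitBox (0 : Fin (k + 1) → ℝ), S0 (k + 1) M β ^ (2 * s)) := by
          refine mul_le_mul_of_nonneg_left ?_ hV0.le
          have htN' : t ≤ (N : ℝ) ^ (k + 1) := htN
          exact sum_integral_perI_le s hk1 ht htN' hN hR hu0 hu1 hM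
      _ ≤ V * (Wconst (k + 1) N t M * (2 ^ (4 * s) * (J (k + 1) s (Finset.Icc (1 : ℤ) ⌊M⌋₊) : ℝ))) := by
          have hW0 : 0 ≤ Wconst (k + 1) N t M := by unfold Wconst; positivity
          refine mul_le_mul_of_nonneg_left (mul_le_mul_of_nonneg_left ?_ hW0) hV0.le
          exact integral_S0_pow_le (k + 1) hs hM
  -- Hölder over `n`
  have hcard : (𝒩.card : ℝ) ≤ N := by
    rw [h𝒩, Nat.card_Ioc]
    have : R - 1 - N ≤ N := by omega
    exact_mod_cast this
  have hexp0 : 0 ≤ 1 - 1 / (2 * s : ℝ) := by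
    have : (1 : ℝ) ≤ s := by exact_mod_cast hs
    rw [sub_nonneg, div_le_one (by positivity)]; linarith
  have hHolder := sum_le_card_rpow_mul 𝒩 (fun n _ => norm_nonneg (Tsum t (n + u) M)) hs
  have hmain : ∑ n ∈ 𝒩, ‖Tsum t (n + u) M‖
      ≤ (N : ℝ) ^ (1 - 1 / (2 * s : ℝ))
        * (V * (Wconst (k + 1) N t M * (2 ^ (4 * s) * (J (k + 1) s (Finset.Icc (1 : ℤ) ⌊M⌋₊) : ℝ))))
          ^ (1 / (2 * s : ℝ)) := by
    refine hHolder.trans ?_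
    gcongr
  -- constants: `(2^{4s})^{1/(2s)} = 4`
  have hfour : ((2 : ℝ) ^ (4 * s)) ^ (1 / (2 * s : ℝ)) = 4 := by
    rw [show (2 : ℝ) ^ (4 * s) = 4 ^ (2 * s) by rw [show 4 * s = 2 * (2 * s) by ring, pow_mul]; norm_num,
      show (1 / (2 * s : ℝ)) = ((2 * s : ℕ) : ℝ)⁻¹ by push_cast; rw [one_div],
      Real.pow_rpow_inv_natCast (by norm_num) (by omega)]
  have hsplit : (V * (Wconst (k + 1) N t M * (2 ^ (4 * s) * (J (k + 1) s (Finset.Icc (1 : ℤ) ⌊M⌋₊) : ℝ))))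
        ^ (1 / (2 * s : ℝ))
      = 4 * (π ^ (k + 1) * (Nat.factorial (k + 1) : ℝ) * ((k + 1 : ℕ) : ℝ) ^ (k + 1) * Wconst (k + 1) N t M * M ^ ((k + 1) * ((k + 1) + 1) / 2)
          * (J (k + 1) s (Finset.Icc (1 : ℤ) ⌊M⌋₊) : ℝ)) ^ (1 / (2 * s : ℝ)) := by
    have hW0 : 0 ≤ Wconst (k + 1) N t M := by unfold Wconst; positivity
    rw [show V * (Wconst (k + 1) N t M * (2 ^ (4 * s) * (J (k + 1) s (Finset.Icc (1 : ℤ) ⌊M⌋₊) : ℝ)))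
        = 2 ^ (4 * s) * (π ^ (k + 1) * (Nat.factorial (k + 1) : ℝ) * ((k + 1 : ℕ) : ℝ) ^ (k + 1) * Wconst (k + 1) N t M * M ^ ((k + 1) * ((k + 1) + 1) / 2)
          * (J (k + 1) s (Finset.Icc (1 : ℤ) ⌊M⌋₊) : ℝ)) by rw [hV]; ring,
      Real.mul_rpow (by positivity) (by positivity), hfour]
  rw [hsplit] at hmain
  -- combine with the Weyl shift
  refine hW.trans ?_
  have hM1 : 0 ≤ 1 / M := by positivity
  have := mul_le_mul_of_nonneg_left hmain hM1
  calc 1 / M * ∑ n ∈ 𝒩, ‖Tsum t (n + u) M‖ + N / M + M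
      ≤ 1 / M * ((N : ℝ) ^ (1 - 1 / (2 * s : ℝ)) * (4 * (π ^ (k + 1) * (Nat.factorial (k + 1) : ℝ) * ((k + 1 : ℕ) : ℝ) ^ (k + 1)
          * Wconst (k + 1) N t M * M ^ ((k + 1) * ((k + 1) + 1) / 2) * (J (k + 1) s (Finset.Icc (1 : ℤ) ⌊M⌋₊) : ℝ))
            ^ (1 / (2 * s : ℝ)))) + N / M + M := by linarith
    _ = _ := by push_cast; ring


/-! ### Ford (6.6) and Corollary 6.4 -/

/-- **Ford (6.6)** (trading the exponent for the constant, pointwise form): if `0 ≤ S ≤ N`,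
`N ≥ 1`, and `S ≤ C N^{1-c}` with `C > 0`, then `S ≤ C^{d/c} N^{1-d}` for `0 < d ≤ c`.
[cite: Ford2002, (6.6)] -/
theorem bound_transfer {S N C c d : ℝ} (hSN : S ≤ N) (hN : 1 ≤ N) (hC : 0 < C)
    (hd : 0 < d) (hdc : d ≤ c) (h : S ≤ C * N ^ (1 - c)) : S ≤ C ^ (d / c) * N ^ (1 - d) := by
  have hc : 0 < c := lt_of_lt_of_le hd hdc
  have hN0 : 0 < N := by linarith
  have hsplit : N ^ (1 - d) = N ^ (-d) * N := by
    rw [← Real.rpow_add_one hN0.ne']; ring_nf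
  rcases le_or_gt N (C ^ (1 / c)) with hle | hgt
  · -- `N ≤ C^{1/c}`: use the trivial bound
    have h1 : N = N ^ d * N ^ (1 - d) := by
      rw [← Real.rpow_add hN0]; ring_nf; exact (Real.rpow_one N).symm
    calc S ≤ N := hSN
      _ = N ^ d * N ^ (1 - d) := h1
      _ ≤ (C ^ (1 / c)) ^ d * N ^ (1 - d) := by
          gcongr
      _ = C ^ (d / c) * N ^ (1 - d) := by
          rw [← Real.rpow_mul hC.le]; congr 1; field_simp
  · -- `N > C^{1/c}`: `C N^{1-c} = C N^{d-c} N^{1-d}` and `C N^{d-c} ≤ C^{d/c}`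
    have h1 : C * N ^ (1 - c) = C * N ^ (d - c) * N ^ (1 - d) := by
      rw [mul_assoc, ← Real.rpow_add hN0]; ring_nf
    have h2 : C * N ^ (d - c) ≤ C ^ (d / c) := by
      have h3 : (C ^ (1 / c)) ^ (c - d) ≤ N ^ (c - d) :=
        Real.rpow_le_rpow (by positivity) hgt.le (by linarith)
      rw [← Real.rpow_mul hC.le] at h3
      have h4 : C ^ (d / c) = C * (C ^ (1 / c * (c - d)))⁻¹ := by
        rw [← Real.rpow_neg hC.le]
        conv_rhs => rw [show C * C ^ (-(1 / c * (c - d))) = C ^ (1 : ℝ) * C ^ (-(1 / c * (c - d))) by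
          rw [Real.rpow_one]]
        rw [← Real.rpow_add hC]
        congr 1; field_simp; ring
      rw [h4, show d - c = -(c - d) by ring, Real.rpow_neg hN0.le]
      refine mul_le_mul_of_nonneg_left ?_ hC.le
      exact inv_anti₀ (by positivity) h3
    calc S ≤ C * N ^ (1 - c) := h
      _ = C * N ^ (d - c) * N ^ (1 - d) := h1
      _ ≤ C ^ (d / c) * N ^ (1 - d) := mul_le_mul_of_nonneg_right h2 (by positivity)

/-- **Ford's Corollary 6.4** (in the form used in the proof of Lemma 6.8). Let `k ≥ 4`, `n ≥ 1`,
`s = nk`, and suppose `J_{s,k}(P) ≤ C P^{2s - k(k+1)/2 + Δ}` for all real `P ≥ 1` (`C > 0`,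
`Δ ≥ 0`). Then for `1 ≤ N < R ≤ 2N`, `0 < u ≤ 1` and `N^{k-1} ≤ t ≤ N^k`,
`|∑_{N<n≤R} (n+u)^{-it}| ≤ (4 (k! (2πk)^k C)^{1/(2nk)} + 2) N^{1-c}`,
`c = (1 - (2+2Δ)/(k+1))/(2nk)`: Lemma 6.3 with `M = N t^{-1/(k+1)} ∈ [N^{1/(k+1)}, N^{2/(k+1)}]`,
`W ≤ 2^k M`, and `N/M + M ≤ 2N^{1-c}`. [cite: Ford2002, Corollary 6.4 and proof of Lemma 6.8] -/
theorem ford_cor64 {k n N R : ℕ} {t u C Δ : ℝ} (hk : 4 ≤ k) (hn : 1 ≤ n) (hN : 1 ≤ N)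
    (hNR : N < R) (hR : R ≤ 2 * N) (hu0 : 0 < u) (hu1 : u ≤ 1) (hC : 0 < C) (hΔ : 0 ≤ Δ)
    (ht1 : (N : ℝ) ^ (k - 1) ≤ t) (ht2 : t ≤ (N : ℝ) ^ k)
    (hJ : ∀ P : ℝ, 1 ≤ P → (J k (n * k) (Finset.Icc (1 : ℤ) ⌊P⌋₊) : ℝ)
      ≤ C * P ^ ((2 * (n * k) : ℕ) - ((k * (k + 1) / 2 : ℕ) : ℝ) + Δ)) :
    ‖∑ n ∈ Ioc N R, ((n : ℂ) + u) ^ (-(t * Complex.I))‖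
      ≤ (4 * ((Nat.factorial k : ℝ) * (2 * π * k) ^ k * C) ^ (1 / (2 * ((n * k : ℕ) : ℝ))) + 2)
          * (N : ℝ) ^ (1 - (1 - (2 + 2 * Δ) / (k + 1)) / (2 * ((n * k : ℕ) : ℝ))) := by
  set s := n * k with hs
  have hs1 : 1 ≤ s := by rw [hs]; nlinarith
  have hk1 : 1 ≤ k := by omega
  have hNpos : (0 : ℝ) < N := by exact_mod_cast hN
  have hN1 : (1 : ℝ) ≤ N := by exact_mod_cast hN
  have hNt : (N : ℝ) ≤ t := by
    refine le_trans ?_ ht1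
    calc (N : ℝ) = N ^ 1 := (pow_one _).symm
      _ ≤ N ^ (k - 1) := pow_le_pow_right₀ hN1 (by omega)
  have ht : 0 < t := lt_of_lt_of_le hNpos hNt
  have hsR : (0 : ℝ) < 2 * (s : ℝ) := by positivity
  have hkR : (0 : ℝ) < (k : ℝ) + 1 := by positivity
  -- the choice of `M`
  set B : ℝ := (N : ℝ) ^ (k + 1) / t with hB
  have hB0 : 0 < B := by positivity
  set M : ℝ := B ^ (1 / ((k : ℝ) + 1)) with hM
  have hM0 : 0 < M := Real.rpow_pos_of_pos hB0 _
  have hMpow : M ^ (k + 1) = B := by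
    rw [hM, ← Real.rpow_natCast, ← Real.rpow_mul hB0.le]
    push_cast
    rw [one_div_mul_cancel hkR.ne', Real.rpow_one]
  have hMt : t * M ^ (k + 1) ≤ (N : ℝ) ^ (k + 1) := by
    rw [hMpow, hB, mul_div_cancel₀ _ ht.ne']
  have hB1 : (N : ℝ) ≤ B := by
    rw [hB, le_div_iff₀ ht, pow_succ, mul_comm ((N : ℝ) ^ k)]
    exact mul_le_mul_of_nonneg_left ht2 hNpos.le
  have hB2 : B ≤ (N : ℝ) ^ 2 := by
    rw [hB, div_le_iff₀ ht]
    calc (N : ℝ) ^ (k + 1) = (N : ℝ) ^ 2 * N ^ (k - 1) := by rw [← pow_add]; congr 1; omega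
      _ ≤ (N : ℝ) ^ 2 * t := mul_le_mul_of_nonneg_left ht1 (by positivity)
  have hM1 : 1 ≤ M := Real.one_le_rpow (hN1.trans hB1) (by positivity)
  have hMup : M ≤ (N : ℝ) ^ (2 / ((k : ℝ) + 1)) := by
    calc M ≤ ((N : ℝ) ^ 2) ^ (1 / ((k : ℝ) + 1)) := Real.rpow_le_rpow hB0.le hB2 (by positivity)
      _ = (N : ℝ) ^ (2 / ((k : ℝ) + 1)) := by
          rw [← Real.rpow_natCast, ← Real.rpow_mul hNpos.le]; push_cast; ring_nf
  have hMlow : (N : ℝ) ^ (1 / ((k : ℝ) + 1)) ≤ M := Real.rpow_le_rpow hNpos.le hB1 (by positivity)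
  have hNM : (N : ℝ) / M ≤ (N : ℝ) ^ ((k : ℝ) / (k + 1)) := by
    rw [div_le_iff₀ hM0]
    calc (N : ℝ) = (N : ℝ) ^ ((k : ℝ) / (k + 1)) * (N : ℝ) ^ (1 / ((k : ℝ) + 1)) := by
          rw [← Real.rpow_add hNpos]
          have : (k : ℝ) / (k + 1) + 1 / ((k : ℝ) + 1) = 1 := by field_simp
          rw [this, Real.rpow_one]
      _ ≤ (N : ℝ) ^ ((k : ℝ) / (k + 1)) * M := mul_le_mul_of_nonneg_left hMlow (by positivity)
  -- Lemma 6.3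
  have hL := ford_lemma63 (s := s) (by omega : 2 ≤ k) hs1 hN hNR hR hu0 hu1 hNt ht2 hM1 hMt
  -- `W ≤ 2^k M`
  have hW : Wconst k N t M ≤ 2 ^ k * M := by
    unfold Wconst
    have hk4 : (4 : ℝ) ≤ k := by exact_mod_cast hk
    have e1 : (2 : ℝ) ^ (k + 2) * (N : ℝ) ^ (k + 1) / ((k : ℝ) ^ 2 * t * M ^ k)
        = 2 ^ k * M * (4 / (k : ℝ) ^ 2) := by
      have : (N : ℝ) ^ (k + 1) = t * M ^ (k + 1) := by rw [hMpow, hB, mul_div_cancel₀ _ ht.ne']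
      rw [this]
      field_simp
      ring
    rw [e1]
    have h16 : (1 : ℝ) ≤ 2 ^ k * M * (1 / 2) := by
      have : (16 : ℝ) ≤ 2 ^ k := by
        calc (16 : ℝ) = 2 ^ 4 := by norm_num
          _ ≤ 2 ^ k := pow_le_pow_right₀ (by norm_num) hk
      nlinarith
    have h4k : 4 / (k : ℝ) ^ 2 ≤ 1 / 4 := by
      rw [div_le_div_iff₀ (by positivity) (by positivity)]; nlinarith
    have hpos : (0 : ℝ) ≤ 2 ^ k * M := by positivity
    nlinarith [mul_le_mul_of_nonneg_left h4k hpos]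
  -- `J ≤ C M^{e}`
  have hJM := hJ M hM1
  -- the product inside the root
  set A : ℝ := (Nat.factorial k : ℝ) * (2 * π * k) ^ k * C with hA
  have hA0 : 0 < A := by positivity
  set e : ℝ := ((2 * s : ℕ) : ℝ) - ((k * (k + 1) / 2 : ℕ) : ℝ) + Δ with he
  have hX : π ^ k * (Nat.factorial k : ℝ) * (k : ℝ) ^ k * Wconst k N t M * M ^ (k * (k + 1) / 2)
        * (J k s (Finset.Icc (1 : ℤ) ⌊M⌋₊) : ℝ)
      ≤ A * M ^ (2 * (s : ℝ) + 1 + Δ) := by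
    have hW0 : 0 ≤ Wconst k N t M := by unfold Wconst; positivity
    calc π ^ k * (Nat.factorial k : ℝ) * (k : ℝ) ^ k * Wconst k N t M * M ^ (k * (k + 1) / 2)
          * (J k s (Finset.Icc (1 : ℤ) ⌊M⌋₊) : ℝ)
        ≤ π ^ k * (Nat.factorial k : ℝ) * (k : ℝ) ^ k * (2 ^ k * M) * M ^ (k * (k + 1) / 2)
          * (C * M ^ e) := by gcongr
      _ = A * (M ^ ((1 : ℕ) : ℝ) * M ^ (((k * (k + 1) / 2 : ℕ)) : ℝ) * M ^ e) := by
          rw [Real.rpow_natCast, Real.rpow_natCast, pow_one, hA]; ring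
      _ = A * M ^ (2 * (s : ℝ) + 1 + Δ) := by
          rw [← Real.rpow_add hM0, ← Real.rpow_add hM0]
          congr 2
          rw [he]; push_cast; ring
  -- take the `1/(2s)`-th root
  have hroot : (π ^ k * (Nat.factorial k : ℝ) * (k : ℝ) ^ k * Wconst k N t M * M ^ (k * (k + 1) / 2)
        * (J k s (Finset.Icc (1 : ℤ) ⌊M⌋₊) : ℝ)) ^ (1 / (2 * s : ℝ))
      ≤ A ^ (1 / (2 * s : ℝ)) * (M * M ^ ((1 + Δ) / (2 * s : ℝ))) := by
    have hW0 : 0 ≤ Wconst k N t M := by unfold Wconst; positivity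
    refine (Real.rpow_le_rpow (by positivity) hX (by positivity)).trans (le_of_eq ?_)
    rw [Real.mul_rpow hA0.le (by positivity), ← Real.rpow_mul hM0.le]
    congr 1
    rw [show (2 * (s : ℝ) + 1 + Δ) * (1 / (2 * s : ℝ)) = 1 + (1 + Δ) / (2 * s : ℝ) by
      field_simp; ring, Real.rpow_add hM0, Real.rpow_one]
  -- the exponent `c`
  set c : ℝ := (1 - (2 + 2 * Δ) / (k + 1)) / (2 * s : ℝ) with hc
  have hcle : c ≤ 1 / ((k : ℝ) + 1) := by
    have h1 : (1 - (2 + 2 * Δ) / ((k : ℝ) + 1)) ≤ 1 := by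
      have : 0 ≤ (2 + 2 * Δ) / ((k : ℝ) + 1) := by positivity
      linarith
    have h2 : (k : ℝ) + 1 ≤ 2 * s := by
      have hnk : k ≤ n * k := by simpa using Nat.mul_le_mul_right k hn
      have : k + 1 ≤ 2 * s := by rw [hs]; omega
      exact_mod_cast this
    calc c ≤ 1 / (2 * s : ℝ) := by rw [hc]; exact div_le_div_of_nonneg_right h1 hsR.le
      _ ≤ 1 / ((k : ℝ) + 1) := one_div_le_one_div_of_le hkR h2
  have hmainexp : (N : ℝ) ^ (1 - 1 / (2 * s : ℝ)) * M ^ ((1 + Δ) / (2 * s : ℝ)) ≤ (N : ℝ) ^ (1 - c) := by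
    calc (N : ℝ) ^ (1 - 1 / (2 * s : ℝ)) * M ^ ((1 + Δ) / (2 * s : ℝ))
        ≤ (N : ℝ) ^ (1 - 1 / (2 * s : ℝ)) * ((N : ℝ) ^ (2 / ((k : ℝ) + 1))) ^ ((1 + Δ) / (2 * s : ℝ)) := by
          gcongr
      _ = (N : ℝ) ^ (1 - c) := by
          rw [← Real.rpow_mul hNpos.le, ← Real.rpow_add hNpos]
          congr 1
          rw [hc]; field_simp; ring
  have hNM' : (N : ℝ) / M ≤ (N : ℝ) ^ (1 - c) :=
    hNM.trans (Real.rpow_le_rpow_of_exponent_le hN1 (by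
      rw [le_sub_iff_add_le]
      have : (k : ℝ) / (k + 1) + 1 / ((k : ℝ) + 1) = 1 := by field_simp
      linarith))
  have hM' : M ≤ (N : ℝ) ^ (1 - c) :=
    hMup.trans (Real.rpow_le_rpow_of_exponent_le hN1 (by
      have hk4 : (4 : ℝ) ≤ k := by exact_mod_cast hk
      have h2 : 2 / ((k : ℝ) + 1) ≤ 1 - 1 / ((k : ℝ) + 1) := by
        rw [show 1 - 1 / ((k : ℝ) + 1) = (k : ℝ) / ((k : ℝ) + 1) by field_simp; ring]
        exact div_le_div_of_nonneg_right (by linarith) hkR.le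
      linarith))
  -- assemble
  refine hL.trans ?_
  have hmain : 4 * (N : ℝ) ^ (1 - 1 / (2 * s : ℝ)) / M
        * (π ^ k * (Nat.factorial k : ℝ) * (k : ℝ) ^ k * Wconst k N t M * M ^ (k * (k + 1) / 2)
          * (J k s (Finset.Icc (1 : ℤ) ⌊M⌋₊) : ℝ)) ^ (1 / (2 * s : ℝ))
      ≤ 4 * A ^ (1 / (2 * s : ℝ)) * (N : ℝ) ^ (1 - c) := by
    calc _ ≤ 4 * (N : ℝ) ^ (1 - 1 / (2 * s : ℝ)) / M
          * (A ^ (1 / (2 * s : ℝ)) * (M * M ^ ((1 + Δ) / (2 * s : ℝ)))) :=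
          mul_le_mul_of_nonneg_left hroot (by positivity)
      _ = 4 * A ^ (1 / (2 * s : ℝ)) * ((N : ℝ) ^ (1 - 1 / (2 * s : ℝ)) * M ^ ((1 + Δ) / (2 * s : ℝ))) := by
          field_simp
      _ ≤ 4 * A ^ (1 / (2 * s : ℝ)) * (N : ℝ) ^ (1 - c) :=
          mul_le_mul_of_nonneg_left hmainexp (by positivity)
  calc _ ≤ 4 * A ^ (1 / (2 * s : ℝ)) * (N : ℝ) ^ (1 - c) + (N : ℝ) ^ (1 - c) + (N : ℝ) ^ (1 - c) := by
        linarith [hmain, hNM', hM']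
    _ = (4 * A ^ (1 / (2 * s : ℝ)) + 2) * (N : ℝ) ^ (1 - c) := by ring

end FordVK
end Literature.NumberTheory.LFunctions
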